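import Literature.NumberTheory.Sieve.GreenTao2008Majorant
import Literature.NumberTheory.Sieve.DivisorBound
import Literature.NumberTheory.Sieve.GoldstonPintzYildirim
import Literature.NumberTheory.Sieve.GreenTao2008CorrelationBound
import HarnessLib

/-!
# Green–Tao (2008), §9: Proposition 9.10 (the correlation condition) from Proposition 9.6

Trunk T-SIEVE. Sibling PROOFS file of `Literature.NumberTheory.Sieve.GreenTao2008Majorant`
(D-0014: named facts are `def X : Prop`; discharges and reductions live next to them). That file
reduced Green–Tao's Proposition 9.1 (`PseudorandomMajorant`) to the two named facts
`MeasureLinearForms` (Prop. 9.8) and `MeasureCorrelation` (Prop. 9.10). Here we prove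

  `MeasureCorrelation_of : GoldstonYildirimCorrelations → MeasureCorrelation`,

i.e. Proposition 9.10 from Proposition 9.6 (the Goldston–Yıldırım higher correlation estimate,
kept as a named fact), following the printed proof (B. Green, T. Tao, Ann. of Math. 167 (2008),
pp. 528–530) through a generic statement `correlationCondition_of_shiftBound` which isolates
what the argument uses about the majorant:

* `ν_N ≥ 0` and `ν_N(x) ≤ 1 + g_N(x)` with `g_N` supported in a window `[ε₀N, 2ε₀N]`,
  `ε₀ < 1/4` (for `ν` of Definition 9.3: `g_N = (φ(W)/W) Λ_R(Wn+1)²/log R · 1_{[ε_k N, 2ε_k N]}`);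
* `‖g_N‖_∞ ≤ N^{o(1)}` (here from `|Λ_R(n)| ≤ d(n) log R` and the divisor bound
  `d(n) ≪_ε n^ε` of the tree's `DivisorBound.lean`, Hardy–Wright Thm 315, in place of the
  maximal-order bound `d(n) ≤ exp(C log n/log log n)` quoted on p. 529 — with the weight at `0`
  taken to be `max(1, ‖ν_N‖_∞)^m` instead of the printed `exp(Cm log N/log log N)`; either choice
  has all moments `o(N)`);
* the shift-correlation bound of Proposition 9.6 in the form
  `∑_{y<N} ∏_i g_N(y + h_i) ≤ (1 + o(1)) N ∏_{p ∣ Δ} (1 + C_m p^{-1/2})` for distinct `|h_i| ≤ N`.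

Contents:
* Lemma 9.9: the weight `gyWeight K n = τ_K(n) = ∏_{p ∣ n} (1 + p^{-1/2})^K`, the pointwise
  bound `τ_K(n) ≤ 2^{K·16K⁴} ∑_{d ∣ n} d^{-1/4}` (`(1 + p^{-1/2})^K ≤ 1 + p^{-1/4}` for
  `p ≥ 16 K⁴`; `∏_{p ∣ n}(1 + p^{-1/4}) ≤ ∑_{d ∣ n} d^{-1/4}`), and the moment bound
  `∑_{0 < n ≤ N} τ_K(n) ≤ M_K N` (`exists_sum_gyWeight_le`; all moments at once since
  `τ_K^q = τ_{Kq}`);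
* the key step `sum_prod_shift_le` (one subset `A ⊆ {1,…,m}`, one choice of lifts) and the
  generic `correlationCondition_of_shiftBound` (coincident shifts, `ν ≤ 1 + g`, expansion over
  `A`, reduction of `ℤ_N`-shifts to integer shifts `< N/2` in absolute value, Prop. 9.6 and
  Lemma 9.9, `∑_{i ≠ j} = 2 ∑_{i<j}` for the symmetric weight);
* `MeasureCorrelation_of` (growth bound `G = min(min_{m ≤ 2^{k-1}} G_{9.6}(k,m), ⌊log_4 log N⌋)`);
* the bridge `truncatedDivisorSum_eq_lambdaR`: for `n ≥ 1`, Green–Tao's `Λ_R(n)` is the case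
  `H = {0}`, `ℓ = 0` of the tree's Goldston–Pintz–Yıldırım `Literature.NumberTheory.Sieve.GPY.lambdaR` (same object, two
  sources).

* `MeasureCorrelation_holds` — **Proposition 9.10 DISCHARGED** (appended 2026-08-15): the same
  argument run with the `O_m(1)`-form of Proposition 9.6, which is a THEOREM of the tree
  (`correlation_bound`, `GreenTao2008CorrelationBound.lean`, an elementary proof by Selberg's change
  of variables), after rescaling the measure by a constant (`correlationCondition_of_div_const`).

After this file `PseudorandomMajorant` (Prop. 9.1) rests on `MeasureLinearForms` (Prop. 9.8) alone,
`MeasureCorrelation` being discharged here; the sibling file `GreenTao2008LinearFormsProofs` reduces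
Prop. 9.8 to `GoldstonYildirimLinearForms` (Prop. 9.5), whose printed proof (§10 and the Appendix of
the source) is a contour-integral estimate against `ζ`.

## References

* B. Green, T. Tao, *The primes contain arbitrarily long arithmetic progressions*, Ann. of Math.
  (2) 167 (2008), 481–547: Lemma 9.9 (p. 528), Proposition 9.10 (pp. 529–530).
  [cite: GreenTaoAnnals2008]
* G. H. Hardy, E. M. Wright, *An Introduction to the Theory of Numbers*, Thm 315 (divisor bound;
  via `Literature.NumberTheory.Sieve.DivisorBound`). [cite: HardyWright2008]
-/

noncomputable section

open Filter Finset Topology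
open scoped BigOperators

namespace Literature.NumberTheory.Sieve.GreenTao2008

/-! ### Lemma 9.9: the weight `τ_K(n) = ∏_{p ∣ n} (1 + p^{-1/2})^K` and its first moment -/

/-- The Green–Tao / Goldston–Yıldırım weight `τ_K(n) = ∏_{p ∣ n} (1 + p^{-1/2})^K` on `ℕ`
(`τ_K(0) = 1`, an irrelevant convention: `Nat.primeFactors 0 = ∅`).
[cite: GreenTaoAnnals2008, Lemma 9.9 (proof)] -/
def gyWeight (K n : ℕ) : ℝ :=
  ∏ p ∈ n.primeFactors, (1 + (p : ℝ) ^ (-(1 / 2 : ℝ))) ^ K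

/-- Unfolding `τ_K`. [cite: GreenTaoAnnals2008, Lemma 9.9 (proof)] -/
theorem gyWeight_def (K n : ℕ) :
    gyWeight K n = ∏ p ∈ n.primeFactors, (1 + (p : ℝ) ^ (-(1 / 2 : ℝ))) ^ K := rfl

/-- `τ_K(n) ≥ 1` ("`τ(n) ≥ 1` for all `n ≠ 0`", Lemma 9.9). [cite: GreenTaoAnnals2008, Lemma 9.9] -/
theorem one_le_gyWeight (K n : ℕ) : 1 ≤ gyWeight K n :=
  one_le_prod fun _ _ =>
    one_le_pow₀ (le_add_of_nonneg_right (Real.rpow_nonneg (Nat.cast_nonneg _) _))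

/-- `τ_K(n) ≥ 0`. [cite: GreenTaoAnnals2008, Lemma 9.9] -/
theorem gyWeight_nonneg (K n : ℕ) : 0 ≤ gyWeight K n := zero_le_one.trans (one_le_gyWeight K n)

/-- The convention `τ_K(0) = 1` (empty product). [cite: GreenTaoAnnals2008, Lemma 9.9] -/
@[simp] theorem gyWeight_zero (K : ℕ) : gyWeight K 0 = 1 := by simp [gyWeight]

/-- `τ_K(n)^L = τ_{KL}(n)`: all moments of `τ_K` are first moments of another weight of the same shape.
[cite: GreenTaoAnnals2008, Lemma 9.9 (proof)] -/
theorem gyWeight_pow (K L n : ℕ) : gyWeight K n ^ L = gyWeight (K * L) n := by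
  unfold gyWeight
  rw [← prod_pow]
  refine prod_congr rfl fun p _ => ?_
  rw [← pow_mul]

/-- `τ_K(n)` is monotone in `K`. [cite: GreenTaoAnnals2008, Lemma 9.9 (proof)] -/
theorem gyWeight_mono {K K' : ℕ} (h : K ≤ K') (n : ℕ) : gyWeight K n ≤ gyWeight K' n :=
  prod_le_prod (fun p _ => by positivity)
    (fun p _ => pow_le_pow_right₀ (le_add_of_nonneg_right (by positivity)) h)

/-- `1 + C p^{-1/2} ≤ (1 + p^{-1/2})^K` for `C ≤ K` (Bernoulli): the step
"`∏_{p ∣ Δ} (1 + O_m(p^{-1/2})) ≤ ∏ (1 + p^{-1/2})^{O_m(1)}`" of Lemma 9.9.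
[cite: GreenTaoAnnals2008, Lemma 9.9 (proof)] -/
theorem one_add_mul_rpow_le_pow {C : ℝ} {K : ℕ} (hCK : C ≤ K) (p : ℕ) :
    1 + C * (p : ℝ) ^ (-(1 / 2 : ℝ)) ≤ (1 + (p : ℝ) ^ (-(1 / 2 : ℝ))) ^ K := by
  have hx : 0 ≤ (p : ℝ) ^ (-(1 / 2 : ℝ)) := by positivity
  calc 1 + C * (p : ℝ) ^ (-(1 / 2 : ℝ)) ≤ 1 + (K : ℝ) * (p : ℝ) ^ (-(1 / 2 : ℝ)) := by gcongr
    _ ≤ (1 + (p : ℝ) ^ (-(1 / 2 : ℝ))) ^ K := one_add_mul_le_pow (by linarith) K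

/-- "`(1 + p^{-1/2})^{O_m(q)}` is bounded by `1 + p^{-1/4}` for all but `O_{m,q}(1)` primes `p`":
here for `p ≥ 16 K⁴`, `p ≥ 1`. [cite: GreenTaoAnnals2008, Lemma 9.9 (proof)] -/
theorem one_add_rpow_pow_le {K p : ℕ} (hp : 1 ≤ p) (hKp : 16 * K ^ 4 ≤ p) :
    (1 + (p : ℝ) ^ (-(1 / 2 : ℝ))) ^ K ≤ 1 + (p : ℝ) ^ (-(1 / 4 : ℝ)) := by
  rcases Nat.eq_zero_or_pos K with rfl | hK
  · rw [pow_zero]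
    exact le_add_of_nonneg_right (by positivity)
  have hp0 : (0 : ℝ) < p := by exact_mod_cast hp
  set x : ℝ := (p : ℝ) ^ (-(1 / 2 : ℝ)) with hx_def
  set u : ℝ := (p : ℝ) ^ (-(1 / 4 : ℝ)) with hu_def
  have hx0 : 0 ≤ x := by positivity
  have hu0 : 0 ≤ u := by positivity
  have hxu : x = u * u := by
    rw [hx_def, hu_def, ← Real.rpow_add hp0]; norm_num
  -- `2 K u ≤ 1` from `p ≥ (2K)^4`
  have h2Ku : 2 * K * u ≤ 1 := by
    have h4 : ((2 * K : ℕ) : ℝ) ^ (4 : ℕ) ≤ p := by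
      exact_mod_cast (show (2 * K) ^ 4 ≤ p by
        calc (2 * K) ^ 4 = 16 * K ^ 4 := by ring
          _ ≤ p := hKp)
    have h2K : ((2 * K : ℕ) : ℝ) ≤ (p : ℝ) ^ (1 / 4 : ℝ) := by
      calc ((2 * K : ℕ) : ℝ) = ((((2 * K : ℕ) : ℝ)) ^ (4 : ℕ)) ^ ((4 : ℕ) : ℝ)⁻¹ :=
            (Real.pow_rpow_inv_natCast (by positivity) four_ne_zero).symm
        _ ≤ (p : ℝ) ^ ((4 : ℕ) : ℝ)⁻¹ := Real.rpow_le_rpow (by positivity) h4 (by positivity)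
        _ = (p : ℝ) ^ (1 / 4 : ℝ) := by norm_num
    have hinv : (p : ℝ) ^ (1 / 4 : ℝ) * u = 1 := by
      rw [hu_def, ← Real.rpow_add hp0]; norm_num
    have hq : 0 ≤ (p : ℝ) ^ (1 / 4 : ℝ) := by positivity
    calc 2 * K * u = ((2 * K : ℕ) : ℝ) * u := by push_cast; ring
      _ ≤ (p : ℝ) ^ (1 / 4 : ℝ) * u := by gcongr
      _ = 1 := hinv
  have hu1 : u ≤ 1 := by
    have : (1 : ℝ) ≤ 2 * K := by
      have : (1 : ℝ) ≤ K := by exact_mod_cast hK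
      linarith
    nlinarith
  have hKx : K * x ≤ 1 := by
    rw [hxu]
    calc (K : ℝ) * (u * u) = (K * u) * u := by ring
      _ ≤ 1 * 1 := by
          apply mul_le_mul _ hu1 hu0 zero_le_one
          nlinarith
      _ = 1 := one_mul _
  have hKx0 : 0 ≤ K * x := by positivity
  -- `(1 + x)^K ≤ exp(K x) ≤ 1 + K x + (K x)^2 ≤ 1 + 2 K x = 1 + (2 K u) u ≤ 1 + u`
  have h1 : (1 + x) ^ K ≤ Real.exp (K * x) := by
    calc (1 + x) ^ K ≤ (Real.exp x) ^ K :=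
          pow_le_pow_left₀ (by positivity) (by linarith [Real.add_one_le_exp x]) K
      _ = Real.exp (K * x) := (Real.exp_nat_mul x K).symm
  have h2 : Real.exp (K * x) ≤ 1 + K * x + (K * x) ^ 2 := by
    have h := Real.abs_exp_sub_one_sub_id_le (x := K * x) (by rw [abs_of_nonneg hKx0]; exact hKx)
    have := (abs_le.1 h).2
    linarith
  have h3 : (K * x) ^ 2 ≤ K * x := by nlinarith
  calc (1 + x) ^ K ≤ 1 + K * x + (K * x) ^ 2 := h1.trans h2
    _ ≤ 1 + 2 * (K * x) := by linarith
    _ = 1 + (2 * K * u) * u := by rw [hxu]; ring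
    _ ≤ 1 + 1 * u := by gcongr
    _ = 1 + u := by rw [one_mul]

/-- `∏_{p ∣ n} (1 + p^{-1/4}) ≤ ∑_{d ∣ n} d^{-1/4}` (`n ≥ 1`): expand the product over the prime
factors into squarefree divisors. [cite: GreenTaoAnnals2008, Lemma 9.9 (proof)] -/
theorem prod_primeFactors_one_add_rpow_le {n : ℕ} (hn : n ≠ 0) (r : ℝ) :
    ∏ p ∈ n.primeFactors, (1 + (p : ℝ) ^ r) ≤ ∑ d ∈ n.divisors, (d : ℝ) ^ r := by
  classical
  rw [prod_one_add]
  have hinj : Set.InjOn (fun T : Finset ℕ => ∏ p ∈ T, p) (n.primeFactors.powerset : Set (Finset ℕ)) := by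
    intro T hT T' hT' h
    have hTp : ∀ p ∈ T, p.Prime := fun p hp =>
      Nat.prime_of_mem_primeFactors (mem_powerset.1 (mem_coe.1 hT) hp)
    have hT'p : ∀ p ∈ T', p.Prime := fun p hp =>
      Nat.prime_of_mem_primeFactors (mem_powerset.1 (mem_coe.1 hT') hp)
    have := congrArg Nat.primeFactors h
    simp only at this
    rwa [Nat.primeFactors_prod hTp, Nat.primeFactors_prod hT'p] at this
  have himg : (n.primeFactors.powerset).image (fun T : Finset ℕ => ∏ p ∈ T, p) ⊆ n.divisors := by
    intro d hd
    obtain ⟨T, hT, rfl⟩ := mem_image.1 hd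
    rw [Nat.mem_divisors]
    exact ⟨(prod_dvd_prod_of_subset _ _ _ (mem_powerset.1 hT)).trans
      (Nat.prod_primeFactors_dvd n), hn⟩
  calc ∑ T ∈ n.primeFactors.powerset, ∏ p ∈ T, (p : ℝ) ^ r
      = ∑ T ∈ n.primeFactors.powerset, (((∏ p ∈ T, p : ℕ) : ℝ)) ^ r := by
        refine sum_congr rfl fun T _ => ?_
        rw [Nat.cast_prod, Real.finsetProd_rpow _ _ (fun p _ => Nat.cast_nonneg _)]
    _ = ∑ d ∈ (n.primeFactors.powerset).image (fun T : Finset ℕ => ∏ p ∈ T, p), (d : ℝ) ^ r :=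
        (sum_image (f := fun d : ℕ => (d : ℝ) ^ r) hinj).symm
    _ ≤ ∑ d ∈ n.divisors, (d : ℝ) ^ r :=
        sum_le_sum_of_subset_of_nonneg himg fun d _ _ => by positivity

/-- **Pointwise bound for the weight** (proof of Lemma 9.9): for `n ≥ 1`,
`τ_K(n) ≤ 2^{K P₀} ∑_{d ∣ n} d^{-1/4}` with `P₀ = 16 K⁴` (the primes `p < P₀` contribute at
most `2^K` each, the others at most `1 + p^{-1/4}`). [cite: GreenTaoAnnals2008, Lemma 9.9 (proof)] -/
theorem gyWeight_le_sum_divisors (K : ℕ) {n : ℕ} (hn : n ≠ 0) :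
    gyWeight K n ≤ 2 ^ (K * (16 * K ^ 4)) * ∑ d ∈ n.divisors, (d : ℝ) ^ (-(1 / 4 : ℝ)) := by
  classical
  set P₀ : ℕ := 16 * K ^ 4 with hP₀
  unfold gyWeight
  rw [← prod_filter_mul_prod_filter_not n.primeFactors (fun p => p < P₀)]
  have hsmall : ∏ p ∈ n.primeFactors with p < P₀, (1 + (p : ℝ) ^ (-(1 / 2 : ℝ))) ^ K ≤
      2 ^ (K * P₀) := by
    have hle : ∀ p ∈ n.primeFactors.filter (fun p => p < P₀),
        (1 + (p : ℝ) ^ (-(1 / 2 : ℝ))) ^ K ≤ (2 : ℝ) ^ K := by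
      intro p hp
      have hp1 : (1 : ℝ) ≤ p := by
        exact_mod_cast (Nat.prime_of_mem_primeFactors (mem_filter.1 hp).1).one_le
      apply pow_le_pow_left₀ (by positivity)
      have : (p : ℝ) ^ (-(1 / 2 : ℝ)) ≤ 1 :=
        Real.rpow_le_one_of_one_le_of_nonpos hp1 (by norm_num)
      linarith
    have hcard : #(n.primeFactors.filter (fun p => p < P₀)) ≤ P₀ := by
      calc #(n.primeFactors.filter (fun p => p < P₀)) ≤ #(range P₀) :=
            card_le_card fun p hp => mem_range.2 (mem_filter.1 hp).2
        _ = P₀ := card_range _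
    calc ∏ p ∈ n.primeFactors with p < P₀, (1 + (p : ℝ) ^ (-(1 / 2 : ℝ))) ^ K
        ≤ ∏ _p ∈ n.primeFactors with _p < P₀, (2 : ℝ) ^ K :=
          prod_le_prod (fun p _ => by positivity) hle
      _ = ((2 : ℝ) ^ K) ^ #(n.primeFactors.filter (fun p => p < P₀)) := prod_const _
      _ ≤ ((2 : ℝ) ^ K) ^ P₀ := pow_le_pow_right₀ (one_le_pow₀ (by norm_num)) hcard
      _ = 2 ^ (K * P₀) := by rw [← pow_mul]
  have hlarge : ∏ p ∈ n.primeFactors with ¬ p < P₀, (1 + (p : ℝ) ^ (-(1 / 2 : ℝ))) ^ K ≤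
      ∑ d ∈ n.divisors, (d : ℝ) ^ (-(1 / 4 : ℝ)) := by
    calc ∏ p ∈ n.primeFactors with ¬ p < P₀, (1 + (p : ℝ) ^ (-(1 / 2 : ℝ))) ^ K
        ≤ ∏ p ∈ n.primeFactors with ¬ p < P₀, (1 + (p : ℝ) ^ (-(1 / 4 : ℝ))) := by
          apply prod_le_prod (fun p _ => by positivity)
          intro p hp
          have hp' := mem_filter.1 hp
          exact one_add_rpow_pow_le (Nat.prime_of_mem_primeFactors hp'.1).one_le (not_lt.1 hp'.2)
      _ ≤ ∏ p ∈ n.primeFactors, (1 + (p : ℝ) ^ (-(1 / 4 : ℝ))) :=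
          prod_le_prod_of_subset_of_one_le (filter_subset _ _) (fun p _ => by positivity)
            (fun p _ _ => le_add_of_nonneg_right (by positivity))
      _ ≤ ∑ d ∈ n.divisors, (d : ℝ) ^ (-(1 / 4 : ℝ)) := prod_primeFactors_one_add_rpow_le hn _
  have h0 : 0 ≤ ∏ p ∈ n.primeFactors with ¬ p < P₀, (1 + (p : ℝ) ^ (-(1 / 2 : ℝ))) ^ K :=
    prod_nonneg fun p _ => by positivity
  calc (∏ p ∈ n.primeFactors with p < P₀, (1 + (p : ℝ) ^ (-(1 / 2 : ℝ))) ^ K) *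
        ∏ p ∈ n.primeFactors with ¬ p < P₀, (1 + (p : ℝ) ^ (-(1 / 2 : ℝ))) ^ K
      ≤ 2 ^ (K * P₀) * ∑ d ∈ n.divisors, (d : ℝ) ^ (-(1 / 4 : ℝ)) :=
        mul_le_mul hsmall hlarge h0 (by positivity)

/-- `∑_{1 ≤ n ≤ N} ∑_{d ∣ n} d^{-1/4} ≤ Z N` with `Z = ∑_d d^{-5/4}`.
[cite: GreenTaoAnnals2008, Lemma 9.9 (proof, last display)] -/
theorem sum_sum_divisors_rpow_le (N : ℕ) :
    ∑ n ∈ Ioc 0 N, ∑ d ∈ n.divisors, (d : ℝ) ^ (-(1 / 4 : ℝ)) ≤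
      (∑' d : ℕ, (d : ℝ) ^ (-(5 / 4 : ℝ))) * N := by
  classical
  have hsumm : Summable fun d : ℕ => (d : ℝ) ^ (-(5 / 4 : ℝ)) :=
    Real.summable_nat_rpow.2 (by norm_num)
  -- exchange the order of summation
  have hex : ∑ n ∈ Ioc 0 N, ∑ d ∈ n.divisors, (d : ℝ) ^ (-(1 / 4 : ℝ)) =
      ∑ d ∈ Ioc 0 N, ∑ n ∈ (Ioc 0 N).filter (fun n => d ∣ n), (d : ℝ) ^ (-(1 / 4 : ℝ)) := by
    apply sum_comm'
    intro n d
    simp only [mem_Ioc, Nat.mem_divisors, mem_filter]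
    constructor
    · rintro ⟨⟨hn0, hnN⟩, hdn, hn⟩
      have hd0 : 0 < d := Nat.pos_of_dvd_of_pos hdn hn0
      exact ⟨⟨⟨hn0, hnN⟩, hdn⟩, hd0, (Nat.le_of_dvd hn0 hdn).trans hnN⟩
    · rintro ⟨⟨⟨hn0, hnN⟩, hdn⟩, hd0, hdN⟩
      exact ⟨⟨hn0, hnN⟩, hdn, by omega⟩
  rw [hex]
  calc ∑ d ∈ Ioc 0 N, ∑ n ∈ (Ioc 0 N).filter (fun n => d ∣ n), (d : ℝ) ^ (-(1 / 4 : ℝ))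
      = ∑ d ∈ Ioc 0 N, ((N / d : ℕ) : ℝ) * (d : ℝ) ^ (-(1 / 4 : ℝ)) := by
        refine sum_congr rfl fun d _ => ?_
        rw [sum_const, nsmul_eq_mul, Nat.Ioc_filter_dvd_card_eq_div]
    _ ≤ ∑ d ∈ Ioc 0 N, (N : ℝ) * (d : ℝ) ^ (-(5 / 4 : ℝ)) := by
        refine sum_le_sum fun d hd => ?_
        have hd0 : (0 : ℝ) < d := by exact_mod_cast (mem_Ioc.1 hd).1
        calc ((N / d : ℕ) : ℝ) * (d : ℝ) ^ (-(1 / 4 : ℝ))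
            ≤ ((N : ℝ) / d) * (d : ℝ) ^ (-(1 / 4 : ℝ)) := by
              gcongr
              exact Nat.cast_div_le
          _ = (N : ℝ) * ((d : ℝ) ^ (-1 : ℝ) * (d : ℝ) ^ (-(1 / 4 : ℝ))) := by
              rw [Real.rpow_neg_one]; ring
          _ = (N : ℝ) * (d : ℝ) ^ (-(5 / 4 : ℝ)) := by
              rw [← Real.rpow_add hd0]; norm_num
    _ = (N : ℝ) * ∑ d ∈ Ioc 0 N, (d : ℝ) ^ (-(5 / 4 : ℝ)) := by rw [mul_sum]
    _ ≤ (N : ℝ) * ∑' d : ℕ, (d : ℝ) ^ (-(5 / 4 : ℝ)) := by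
        gcongr
        exact hsumm.sum_le_tsum _ (fun d _ => by positivity)
    _ = (∑' d : ℕ, (d : ℝ) ^ (-(5 / 4 : ℝ))) * N := mul_comm _ _

/-- **Green–Tao 2008, Lemma 9.9 (moment bound):** `E(τ_K(n) | 0 < n ≤ N) = O_K(1)`, in the form
`∑_{0 < n ≤ N} τ_K(n) ≤ M_K N` (all `q`-th moments at once, as `τ_K^q = τ_{Kq}`).
[cite: GreenTaoAnnals2008, Lemma 9.9] -/
theorem exists_sum_gyWeight_le (K : ℕ) : ∃ M : ℝ, 0 ≤ M ∧ ∀ N : ℕ,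
    ∑ n ∈ Ioc 0 N, gyWeight K n ≤ M * N := by
  refine ⟨2 ^ (K * (16 * K ^ 4)) * ∑' d : ℕ, (d : ℝ) ^ (-(5 / 4 : ℝ)), by positivity, fun N => ?_⟩
  calc ∑ n ∈ Ioc 0 N, gyWeight K n
      ≤ ∑ n ∈ Ioc 0 N, 2 ^ (K * (16 * K ^ 4)) * ∑ d ∈ n.divisors, (d : ℝ) ^ (-(1 / 4 : ℝ)) :=
        sum_le_sum fun n hn => gyWeight_le_sum_divisors K (mem_Ioc.1 hn).1.ne'
    _ = 2 ^ (K * (16 * K ^ 4)) * ∑ n ∈ Ioc 0 N, ∑ d ∈ n.divisors, (d : ℝ) ^ (-(1 / 4 : ℝ)) := by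
        rw [mul_sum]
    _ ≤ 2 ^ (K * (16 * K ^ 4)) * ((∑' d : ℕ, (d : ℝ) ^ (-(5 / 4 : ℝ))) * N) := by
        gcongr
        exact sum_sum_divisors_rpow_le N
    _ = _ := by ring


/-! ### Elementary inequalities used in the proof of Proposition 9.10 -/

/-- `∏_{s} X ≤ ∑_{s} X^P` for `X ≥ 1` on a nonempty `s` with `#s ≤ P` ("by the arithmetic
mean-geometric mean inequality", p. 528 — here the cruder `∏ X ≤ (max X)^{#s}`).
[cite: GreenTaoAnnals2008, Lemma 9.9 (proof)] -/
theorem prod_le_sum_pow_of_one_le {ι : Type*} {s : Finset ι} (hs : s.Nonempty) {X : ι → ℝ}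
    (h1 : ∀ i ∈ s, 1 ≤ X i) {P : ℕ} (hP : #s ≤ P) : ∏ i ∈ s, X i ≤ ∑ i ∈ s, X i ^ P := by
  obtain ⟨i₀, hi₀, hmax⟩ := exists_max_image s X hs
  calc ∏ i ∈ s, X i ≤ ∏ _i ∈ s, X i₀ :=
        prod_le_prod (fun i hi => zero_le_one.trans (h1 i hi)) hmax
    _ = X i₀ ^ #s := prod_const _
    _ ≤ X i₀ ^ P := pow_le_pow_right₀ (h1 i₀ hi₀) hP
    _ ≤ ∑ i ∈ s, X i ^ P :=
        single_le_sum (f := fun i => X i ^ P) (fun i hi => pow_nonneg (zero_le_one.trans (h1 i hi)) P)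
          hi₀

/-- `∏_{⋃ t_i} f ≤ ∏_i ∏_{t_i} f` for `f ≥ 1`. [folklore] -/
theorem prod_biUnion_le_real {ι κ : Type*} [DecidableEq ι] [DecidableEq κ] (s : Finset ι)
    (t : ι → Finset κ) {f : κ → ℝ} (h1 : ∀ k, 1 ≤ f k) :
    ∏ k ∈ s.biUnion t, f k ≤ ∏ i ∈ s, ∏ k ∈ t i, f k := by
  have h0 : ∀ k, 0 ≤ f k := fun k => zero_le_one.trans (h1 k)
  induction s using Finset.induction_on with
  | empty => simp
  | @insert a s ha ih =>
    rw [biUnion_insert, prod_insert ha]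
    have hU : ∏ k ∈ t a ∪ s.biUnion t, f k ≤ (∏ k ∈ t a, f k) * ∏ k ∈ s.biUnion t, f k := by
      rw [← prod_union_inter]
      have h2 : 1 ≤ ∏ k ∈ t a ∩ s.biUnion t, f k := one_le_prod fun k _ => h1 k
      have h3 : 0 ≤ ∏ k ∈ t a ∪ s.biUnion t, f k := prod_nonneg fun k _ => h0 k
      calc ∏ k ∈ t a ∪ s.biUnion t, f k = (∏ k ∈ t a ∪ s.biUnion t, f k) * 1 := (mul_one _).symm
        _ ≤ (∏ k ∈ t a ∪ s.biUnion t, f k) * ∏ k ∈ t a ∩ s.biUnion t, f k :=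
            mul_le_mul_of_nonneg_left h2 h3
    exact hU.trans (mul_le_mul_of_nonneg_left ih (prod_nonneg fun k _ => h0 k))

/-! ### Sums over `ℤ_N` as sums over `{0, …, N-1}`; the centred representative -/

/-- `∑_{x ∈ ℤ_N} F(x) = ∑_{n < N} F(n)` through the representatives `x.val ∈ [0, N)`. [folklore] -/
theorem sum_zmod_eq_sum_range {N : ℕ} [NeZero N] (F : ℕ → ℝ) :
    ∑ x : ZMod N, F x.val = ∑ n ∈ range N, F n := by
  refine sum_nbij ZMod.val (fun x _ => mem_range.2 (ZMod.val_lt x)) ?_ ?_ (fun _ _ => rfl)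
  · exact fun x _ y _ h => ZMod.val_injective N h
  · intro n hn
    exact ⟨(n : ZMod N), by simp, ZMod.val_cast_of_lt (mem_range.1 hn)⟩

/-- `E(F | ℤ_N) = N⁻¹ ∑_{x ∈ ℤ_N} F(x)`. [folklore] -/
theorem expect_zmod_eq_sum_div {N : ℕ} [NeZero N] (F : ZMod N → ℝ) :
    𝔼 x, F x = (∑ x, F x) / N := by
  rw [expect_eq_sum_div_card, card_univ, ZMod.card]

/-- The centred representative of a small integer is itself: for `2|z| < N`,
`(z mod N).valMinAbs = z` ("identifying `ℤ_N` with the integers between `-N/2` and `+N/2`", p. 529).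
[folklore] -/
theorem valMinAbs_intCast_of_two_mul_abs_lt {N : ℕ} [NeZero N] {z : ℤ} (hz : 2 * |z| < N) :
    ((z : ZMod N)).valMinAbs = z := by
  rw [ZMod.valMinAbs_spec]
  refine ⟨rfl, ?_, ?_⟩
  · have := (abs_lt.1 (show |z| < N by linarith [abs_nonneg z])).1
    linarith [neg_abs_le z, le_abs_self z, abs_nonneg z]
  · linarith [le_abs_self z]

/-- Reduction modulo `N` of a shift, for a function supported in `[0, N)`:
`g((y + c) mod N) = g(y + c) + g(y + c - N)` for `0 ≤ y, c < N`. [folklore] -/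
theorem apply_mod_eq_add_of_support {N : ℕ} {g : ℤ → ℝ}
    (hg : ∀ n, g n ≠ 0 → 0 ≤ n ∧ n < N) {y c : ℕ} (hy : y < N) (hc : c < N) :
    g ((y + c) % N : ℕ) = g ((y : ℤ) + c) + g ((y : ℤ) + c - N) := by
  by_cases h : y + c < N
  · rw [Nat.mod_eq_of_lt h]
    have h2 : g ((y : ℤ) + c - N) = 0 := by
      by_contra hne
      have := (hg _ hne).1
      omega
    rw [h2, add_zero]; push_cast; rfl
  · push Not at h
    have hlt : y + c - N < N := by omega
    rw [Nat.mod_eq_sub_mod h, Nat.mod_eq_of_lt hlt]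
    have h1 : g ((y : ℤ) + c) = 0 := by
      by_contra hne
      have := (hg _ hne).2
      omega
    rw [h1, zero_add]; push_cast [Nat.cast_sub h]; rfl

/-- Symmetric sums over ordered pairs: `∑_{i ≠ j} F(i,j) = 2 ∑_{i < j} F(i,j)` for symmetric `F`.
[folklore] -/
theorem sum_offDiag_eq_two_mul_of_symm {m : ℕ} (F : Fin m → Fin m → ℝ)
    (hF : ∀ i j, F i j = F j i) :
    ∑ ij ∈ (univ : Finset (Fin m)).offDiag, F ij.1 ij.2 =
      2 * ∑ i : Fin m, ∑ j : Fin m with i < j, F i j := by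
  classical
  rw [← sum_filter_add_sum_filter_not _ (fun ij : Fin m × Fin m => ij.1 < ij.2)]
  have hA : ∑ ij ∈ (univ : Finset (Fin m)).offDiag with ij.1 < ij.2, F ij.1 ij.2 =
      ∑ i : Fin m, ∑ j : Fin m with i < j, F i j := by
    rw [sum_filter]
    have : ∑ ij ∈ (univ : Finset (Fin m)).offDiag, (if ij.1 < ij.2 then F ij.1 ij.2 else 0) =
        ∑ ij ∈ (univ : Finset (Fin m)) ×ˢ (univ : Finset (Fin m)),
          (if ij.1 < ij.2 then F ij.1 ij.2 else 0) := by
      apply sum_subset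
      · intro ij hij
        exact mem_product.2 ⟨mem_univ _, mem_univ _⟩
      · intro ij _ hij
        rw [mem_offDiag] at hij
        have : ¬ ij.1 < ij.2 := fun hlt => hij ⟨mem_univ _, mem_univ _, hlt.ne⟩
        rw [if_neg this]
    rw [this, sum_product]
    refine sum_congr rfl fun i _ => ?_
    rw [sum_filter]
  have hB : ∑ ij ∈ (univ : Finset (Fin m)).offDiag with ¬ ij.1 < ij.2, F ij.1 ij.2 =
      ∑ ij ∈ (univ : Finset (Fin m)).offDiag with ij.1 < ij.2, F ij.1 ij.2 := by
    refine sum_nbij Prod.swap ?_ ?_ ?_ ?_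
    · intro ij hij
      simp only [mem_filter, mem_offDiag, mem_univ, true_and] at hij ⊢
      exact ⟨hij.1.symm, lt_of_le_of_ne (not_lt.1 hij.2) hij.1.symm⟩
    · exact fun ij _ ij' _ h => Prod.swap_injective h
    · intro ij hij
      simp only [Set.mem_image, mem_coe, mem_filter, mem_offDiag, mem_univ, true_and] at hij ⊢
      exact ⟨ij.swap, ⟨hij.1.symm, not_lt.2 hij.2.le⟩, Prod.swap_swap ij⟩
    · intro ij _
      exact hF _ _
  rw [hA, hB, hA]; ring


/-- `∑_{j < N} f(j+1) = ∑_{0 < n ≤ N} f(n)`. [folklore] -/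
theorem sum_range_succ_eq_sum_Ioc (f : ℕ → ℝ) (N : ℕ) :
    ∑ j ∈ range N, f (j + 1) = ∑ n ∈ Ioc 0 N, f n := by
  induction N with
  | zero => simp
  | succ N ih => rw [sum_range_succ, sum_Ioc_succ_top (Nat.zero_le _), ih]

/-- First moment of `n ↦ τ_K(|n|)` over the centred representatives of `ℤ_N`:
`∑_{x ∈ ℤ_N} τ_K(|x̃|) ≤ (2 M_K + 1) N`. [cite: GreenTaoAnnals2008, Lemma 9.9] -/
theorem sum_zmod_gyWeight_le {K : ℕ} {M' : ℝ} (hM' : ∀ N : ℕ, ∑ n ∈ Ioc 0 N, gyWeight K n ≤ M' * N)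
    {N : ℕ} [NeZero N] (hN1 : 1 ≤ N) :
    ∑ x : ZMod N, gyWeight K x.valMinAbs.natAbs ≤ (2 * M' + 1) * N := by
  have hv : ∀ x : ZMod N, gyWeight K x.valMinAbs.natAbs = gyWeight K (min x.val (N - x.val)) :=
    fun x => by rw [ZMod.valMinAbs_natAbs_eq_min]
  simp_rw [hv]
  rw [sum_zmod_eq_sum_range (fun n => gyWeight K (min n (N - n)))]
  have h1 : ∑ n ∈ range N, gyWeight K (min n (N - n)) ≤
      ∑ n ∈ range N, gyWeight K n + ∑ n ∈ range N, gyWeight K (N - n) := by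
    rw [← sum_add_distrib]
    refine sum_le_sum fun n _ => ?_
    rcases min_cases n (N - n) with ⟨h, -⟩ | ⟨h, -⟩ <;> rw [h] <;>
      linarith [gyWeight_nonneg K n, gyWeight_nonneg K (N - n)]
  have h2 : ∑ n ∈ range N, gyWeight K (N - n) = ∑ n ∈ Ioc 0 N, gyWeight K n := by
    rw [← sum_range_succ_eq_sum_Ioc, ← sum_range_reflect (fun j => gyWeight K (j + 1)) N]
    refine sum_congr rfl fun j hj => ?_
    congr 1
    have := mem_range.1 hj
    omega
  have h3 : ∑ n ∈ range N, gyWeight K n ≤ 1 + ∑ n ∈ Ioc 0 N, gyWeight K n := by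
    calc ∑ n ∈ range N, gyWeight K n ≤ ∑ n ∈ range (N + 1), gyWeight K n :=
          sum_le_sum_of_subset_of_nonneg (range_subset_range.2 (Nat.le_succ N)) fun n _ _ => gyWeight_nonneg K n
      _ = 1 + ∑ n ∈ Ioc 0 N, gyWeight K n := by
          rw [sum_range_succ', sum_range_succ_eq_sum_Ioc, gyWeight_zero, add_comm]
  have h4 := hM' N
  have hN1' : (1 : ℝ) ≤ N := by exact_mod_cast hN1
  linarith

/-! ### Proposition 9.10 in generic form -/

/-- The primes dividing some difference `h_i - h_j`, `i ≠ j` (the diagonal contributes nothing: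
`Nat.primeFactors 0 = ∅`). For distinct `h_i` these are exactly the primes dividing
`Δ = ∏_{i<j} |h_i - h_j|` of Proposition 9.6. [cite: GreenTaoAnnals2008, Proposition 9.6] -/
def pairPrimeFactors {m : ℕ} (h : Fin m → ℤ) : Finset ℕ :=
  (univ : Finset (Fin m × Fin m)).biUnion fun ij => (h ij.1 - h ij.2).natAbs.primeFactors

/-- Unfolding `pairPrimeFactors`. [cite: GreenTaoAnnals2008, Proposition 9.6] -/
theorem pairPrimeFactors_def {m : ℕ} (h : Fin m → ℤ) : pairPrimeFactors h =
    (univ : Finset (Fin m × Fin m)).biUnion fun ij => (h ij.1 - h ij.2).natAbs.primeFactors := rfl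

/-- **The key step of the proof of Proposition 9.10** (p. 530, "Suppose then that the `h_i` are
distinct …"), for one subset `S = A ⊆ {1, …, m}` and one choice of integer lifts `d_i` of the
shifts `h_i ∈ ℤ_N` (`|d_i| ≤ N`, distinct): either `∑_{y < N} ∏_{i ∈ S} g(y + d_i)` vanishes, or
all `|d_i - d_j| ≤ ε₀ N` (the support of `g`), the correlation bound applies, and its arithmetic
factor `∏_{p ∣ Δ} (1 + C p^{-1/2})` is at most `∏_{i ≠ j} τ_K(|d_i - d_j|) ≤ ∑ τ_K^P` (Lemma 9.9,
first display), where `|d_i - d_j|` is the centred representative of `h_i - h_j`.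
[cite: GreenTaoAnnals2008, Proposition 9.10 (proof) and Lemma 9.9] -/
theorem sum_prod_shift_le {N m K P : ℕ} [NeZero N] {g : ℤ → ℝ} {ε₀ : ℝ} (hε₁ : ε₀ < 1 / 4)
    (hsupp : ∀ n, g n ≠ 0 → ε₀ * N ≤ (n : ℝ) ∧ (n : ℝ) ≤ 2 * ε₀ * N)
    (Cf : ℕ → ℝ) (hCf0 : ∀ m', 1 ≤ m' → m' ≤ m → 0 ≤ Cf m')
    (hCfK : ∀ m', 1 ≤ m' → m' ≤ m → Cf m' ≤ K)
    (HB : ∀ m' ∈ Icc 1 m, ∀ h' : Fin m' → ℤ, Function.Injective h' → (∀ i, |h' i| ≤ N) →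
      ∑ y ∈ range N, ∏ i, g (y + h' i) ≤
        2 * N * ∏ p ∈ pairPrimeFactors h', (1 + Cf m' * (p : ℝ) ^ (-(1 / 2 : ℝ))))
    (hm : 2 ≤ m) (hP : m * m ≤ P)
    (h : Fin m → ZMod N) (S : Finset (Fin m)) (d : Fin m → ℤ) (hdS : Set.InjOn d S)
    (hdN : ∀ i ∈ S, |d i| ≤ N) (hdh : ∀ i ∈ S, (d i : ZMod N) = h i) :
    ∑ y ∈ range N, ∏ i ∈ S, g (y + d i) ≤
      4 * N * ∑ ij ∈ (univ : Finset (Fin m)).offDiag,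
        gyWeight K (h ij.1 - h ij.2).valMinAbs.natAbs ^ P := by
  classical
  set G : Fin m × Fin m → ℝ := fun ij => gyWeight K (h ij.1 - h ij.2).valMinAbs.natAbs ^ P
    with hG_def
  set SG : ℝ := ∑ ij ∈ (univ : Finset (Fin m)).offDiag, G ij with hSG_def
  have hG1 : ∀ ij, 1 ≤ G ij := fun ij => one_le_pow₀ (one_le_gyWeight _ _)
  have hG0 : ∀ ij, 0 ≤ G ij := fun ij => zero_le_one.trans (hG1 ij)
  have hmSG : (m : ℝ) ≤ SG := by
    have hcard : m ≤ #((univ : Finset (Fin m)).offDiag) := by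
      rw [offDiag_card, card_univ, Fintype.card_fin]
      have : m + m ≤ m * m := by nlinarith
      omega
    calc (m : ℝ) ≤ #((univ : Finset (Fin m)).offDiag) := by exact_mod_cast hcard
      _ = ∑ _ij ∈ (univ : Finset (Fin m)).offDiag, (1 : ℝ) := by simp
      _ ≤ SG := sum_le_sum fun ij _ => hG1 ij
  have hSG1 : 1 ≤ SG := le_trans (by exact_mod_cast (show 1 ≤ m by omega)) hmSG
  have hN0 : (0 : ℝ) < N := by exact_mod_cast Nat.pos_of_ne_zero (NeZero.ne N)
  -- if the sum vanishes there is nothing to prove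
  by_cases hzero : ∑ y ∈ range N, ∏ i ∈ S, g (y + d i) = 0
  · rw [hzero]; positivity
  -- otherwise all `y₀ + d_i`, `i ∈ S`, lie in the support window for some `y₀`
  obtain ⟨y₀, -, hne⟩ := exists_ne_zero_of_sum_ne_zero hzero
  have hwin : ∀ i ∈ S, ε₀ * N ≤ (((y₀ : ℤ) + d i : ℤ) : ℝ) ∧
      (((y₀ : ℤ) + d i : ℤ) : ℝ) ≤ 2 * ε₀ * N :=
    fun i hi => hsupp _ (prod_ne_zero_iff.1 hne i hi)
  have hdiff : ∀ i ∈ S, ∀ j ∈ S, 2 * |d i - d j| < (N : ℤ) := by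
    intro i hi j hj
    obtain ⟨h1, h2⟩ := hwin i hi
    obtain ⟨h3, h4⟩ := hwin j hj
    push_cast at h1 h2 h3 h4
    have hεN : 0 ≤ ε₀ * N := by linarith
    have hab : |((d i - d j : ℤ) : ℝ)| ≤ ε₀ * N := by
      push_cast
      rw [abs_le]
      constructor <;> linarith
    have hR : (2 : ℝ) * |((d i - d j : ℤ) : ℝ)| < N := by nlinarith
    exact_mod_cast hR
  -- the empty product
  rcases S.eq_empty_or_nonempty with rfl | hSne
  · simp only [prod_empty, sum_const, card_range, nsmul_eq_mul, mul_one]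
    nlinarith
  -- reindex `S` by `Fin m'` and apply the correlation bound
  set m' : ℕ := #S with hm'_def
  have hm'1 : 1 ≤ m' := card_pos.2 hSne
  have hm'm : m' ≤ m := by simpa using card_le_univ S
  set e : Fin m' ≃ S := S.equivFin.symm with he_def
  set h' : Fin m' → ℤ := fun k => d (e k) with hh'_def
  have hinj' : Function.Injective h' := by
    intro k l hkl
    exact e.injective (Subtype.ext (hdS (e k).2 (e l).2 hkl))
  have hbdd' : ∀ k, |h' k| ≤ N := fun k => hdN _ (e k).2
  have hB := HB m' (mem_Icc.2 ⟨hm'1, hm'm⟩) h' hinj' hbdd'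
  have hprod : ∀ y : ℕ, ∏ k, g (y + h' k) = ∏ i ∈ S, g (y + d i) := by
    intro y
    rw [← prod_coe_sort S]
    exact Fintype.prod_equiv e _ _ (fun k => rfl)
  simp_rw [hprod] at hB
  refine hB.trans ?_
  suffices harith : ∏ p ∈ pairPrimeFactors h', (1 + Cf m' * (p : ℝ) ^ (-(1 / 2 : ℝ))) ≤ 2 * SG by
    calc 2 * (N : ℝ) * ∏ p ∈ pairPrimeFactors h', (1 + Cf m' * (p : ℝ) ^ (-(1 / 2 : ℝ)))
        ≤ 2 * N * (2 * SG) := by gcongr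
      _ = 4 * N * SG := by ring
  have hCf0' : 0 ≤ Cf m' := hCf0 m' hm'1 hm'm
  -- Lemma 9.9, first display: the arithmetic factor against the weights
  have hstep1 : ∏ p ∈ pairPrimeFactors h', (1 + Cf m' * (p : ℝ) ^ (-(1 / 2 : ℝ))) ≤
      ∏ kl ∈ (univ : Finset (Fin m' × Fin m')), gyWeight K (h' kl.1 - h' kl.2).natAbs := by
    calc ∏ p ∈ pairPrimeFactors h', (1 + Cf m' * (p : ℝ) ^ (-(1 / 2 : ℝ)))
        ≤ ∏ p ∈ pairPrimeFactors h', (1 + (p : ℝ) ^ (-(1 / 2 : ℝ))) ^ K :=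
          prod_le_prod (fun p _ => by positivity)
            (fun p _ => one_add_mul_rpow_le_pow (hCfK m' hm'1 hm'm) p)
      _ ≤ ∏ kl ∈ (univ : Finset (Fin m' × Fin m')),
            ∏ p ∈ (h' kl.1 - h' kl.2).natAbs.primeFactors, (1 + (p : ℝ) ^ (-(1 / 2 : ℝ))) ^ K :=
          prod_biUnion_le_real _ _ (fun p => one_le_pow₀ (le_add_of_nonneg_right (by positivity)))
      _ = _ := rfl
  -- `∏ ≤ ∑ (·)^P` and back to `S × S`
  have hstep2 : ∏ kl ∈ (univ : Finset (Fin m' × Fin m')), gyWeight K (h' kl.1 - h' kl.2).natAbs ≤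
      ∑ ij ∈ S ×ˢ S, gyWeight K (d ij.1 - d ij.2).natAbs ^ P := by
    calc ∏ kl ∈ (univ : Finset (Fin m' × Fin m')), gyWeight K (h' kl.1 - h' kl.2).natAbs
        ≤ ∑ kl ∈ (univ : Finset (Fin m' × Fin m')), gyWeight K (h' kl.1 - h' kl.2).natAbs ^ P := by
          refine prod_le_sum_pow_of_one_le ⟨(⟨0, hm'1⟩, ⟨0, hm'1⟩), mem_univ _⟩
            (fun kl _ => one_le_gyWeight _ _) ?_
          rw [card_univ, Fintype.card_prod, Fintype.card_fin]
          exact (Nat.mul_le_mul hm'm hm'm).trans hP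
      _ = ∑ k : Fin m', ∑ l : Fin m', gyWeight K (h' k - h' l).natAbs ^ P :=
          Fintype.sum_prod_type _
      _ = ∑ i ∈ S, ∑ j ∈ S, gyWeight K (d i - d j).natAbs ^ P := by
          rw [← sum_coe_sort S]
          refine Fintype.sum_equiv e _ _ (fun k => ?_)
          rw [← sum_coe_sort S]
          exact Fintype.sum_equiv e _ _ (fun l => rfl)
      _ = ∑ ij ∈ S ×ˢ S, gyWeight K (d ij.1 - d ij.2).natAbs ^ P :=
          (sum_product S S (fun ij : Fin m × Fin m => gyWeight K (d ij.1 - d ij.2).natAbs ^ P)).symm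
  -- diagonal and off-diagonal parts of `S × S`
  have hstep3 : ∑ ij ∈ S ×ˢ S, gyWeight K (d ij.1 - d ij.2).natAbs ^ P ≤ 2 * SG := by
    rw [← diag_union_offDiag, sum_union (disjoint_diag_offDiag S)]
    have hdiag : ∑ ij ∈ S.diag, gyWeight K (d ij.1 - d ij.2).natAbs ^ P ≤ SG := by
      calc ∑ ij ∈ S.diag, gyWeight K (d ij.1 - d ij.2).natAbs ^ P = ∑ _ij ∈ S.diag, (1 : ℝ) := by
            refine sum_congr rfl fun ij hij => ?_
            rw [(mem_diag.1 hij).2, sub_self, Int.natAbs_zero, gyWeight_zero, one_pow]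
        _ = m' := by rw [sum_const, nsmul_eq_mul, mul_one, diag_card]
        _ ≤ m := by exact_mod_cast hm'm
        _ ≤ SG := hmSG
    have hoff : ∑ ij ∈ S.offDiag, gyWeight K (d ij.1 - d ij.2).natAbs ^ P ≤ SG := by
      calc ∑ ij ∈ S.offDiag, gyWeight K (d ij.1 - d ij.2).natAbs ^ P = ∑ ij ∈ S.offDiag, G ij := by
            refine sum_congr rfl fun ij hij => ?_
            obtain ⟨hi, hj, hij'⟩ := mem_offDiag.1 hij
            simp only [hG_def]
            congr 2
            rw [← hdh _ hi, ← hdh _ hj, ← Int.cast_sub,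
              valMinAbs_intCast_of_two_mul_abs_lt (hdiff _ hi _ hj)]
        _ ≤ SG := sum_le_sum_of_subset_of_nonneg
            (fun ij hij => mem_offDiag.2 ⟨mem_univ _, mem_univ _, (mem_offDiag.1 hij).2.2⟩)
            (fun ij _ _ => hG0 ij)
    linarith
  linarith

/-- **Green–Tao 2008, Proposition 9.10, in generic form.** Let `ν = (ν_N)` be nonnegative with
`ν_N(x) ≤ 1 + g_N(x)` (`x ∈ ℤ_N` read in `[0, N)`), where `g_N` is supported in a window
`[ε₀ N, 2ε₀ N]`, `ε₀ < 1/4`, satisfies `‖g_N‖_∞ ≤ N^{o(1)}`, and obeys the Goldston–Yıldırım type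
correlation bound of Proposition 9.6 in the form: for `1 ≤ m ≤ m₀` and distinct integer shifts
`|h_i| ≤ N`, `∑_{y<N} ∏_i g_N(y + h_i) ≤ (1 + o(1)) N ∏_{p ∣ Δ} (1 + C_m p^{-1/2})`. Then `ν`
satisfies the `m₀`-correlation condition (Definition 3.2). This is exactly the argument printed
on pp. 529–530 (coincident shifts via the `L^∞` bound and `τ(0)`, distinct shifts via
`ν ≤ 1 + g`, expansion over `A ⊆ {1,…,m}`, Proposition 9.6 and Lemma 9.9), with
`τ_N(h) = 8·3^m τ_K(|h̃|)^{m²} + 1_{h=0} max(1, ‖ν_N‖_∞)^m` (`h̃` the centred representative); the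
`L^∞` bound enters only through `‖ν_N‖_∞ ≤ N^{o(1)}`, which is what makes all moments of `τ(0)/N`
negligible. [cite: GreenTaoAnnals2008, Proposition 9.10 (proof, pp. 529–530)] -/
theorem correlationCondition_of_shiftBound {m₀ : ℕ} {ν : (N : ℕ) → ZMod N → ℝ}
    (g : ℕ → ℤ → ℝ) {ε₀ : ℝ} (hε₁ : ε₀ < 1 / 4)
    (hν0 : ∀ N x, 0 ≤ ν N x)
    (hνg : ∀ᶠ N : ℕ in atTop, ∀ x : ZMod N, ν N x ≤ 1 + g N x.val)
    (hsupp : ∀ N n, g N n ≠ 0 → ε₀ * N ≤ (n : ℝ) ∧ (n : ℝ) ≤ 2 * ε₀ * N)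
    (hsup : ∀ δ : ℝ, 0 < δ → ∀ᶠ N : ℕ in atTop, ∀ n, g N n ≤ (N : ℝ) ^ δ)
    (hcorr : ∀ m, 1 ≤ m → m ≤ m₀ → ∃ C : ℝ, 0 ≤ C ∧ ∀ η : ℝ, 0 < η → ∀ᶠ N : ℕ in atTop,
      N.Prime → ∀ h : Fin m → ℤ, Function.Injective h → (∀ i, |h i| ≤ N) →
        ∑ y ∈ range N, ∏ i, g N (y + h i) ≤
          (1 + η) * N * ∏ p ∈ pairPrimeFactors h, (1 + C * (p : ℝ) ^ (-(1 / 2 : ℝ)))) :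
    CorrelationCondition m₀ ν := by
  classical
  intro m hm1 hmm₀
  choose! Cf hCf0 hCf using hcorr
  -- a uniform exponent `K ≥ C_{m'}` for all `1 ≤ m' ≤ m₀`
  set K : ℕ := ⌈∑ m' ∈ Icc 1 m₀, Cf m'⌉₊ with hK_def
  have hCfK : ∀ m', 1 ≤ m' → m' ≤ m₀ → Cf m' ≤ K := by
    intro m' h1 h2
    calc Cf m' ≤ ∑ m'' ∈ Icc 1 m₀, Cf m'' :=
          single_le_sum (f := Cf) (fun i hi => hCf0 i (mem_Icc.1 hi).1 (mem_Icc.1 hi).2)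
            (mem_Icc.2 ⟨h1, h2⟩)
      _ ≤ K := Nat.le_ceil _
  set P : ℕ := m * m with hP_def
  set A : ℝ := 8 * 3 ^ m with hA_def
  have hA0 : 0 ≤ A := by positivity
  -- `max(1, ‖ν_N‖_∞)`
  set M : ℕ → ℝ := fun N => max 1 (⨆ x : ZMod N, ν N x) with hM_def
  have hM1 : ∀ N, 1 ≤ M N := fun N => le_max_left _ _
  have hM0 : ∀ N, 0 ≤ M N := fun N => zero_le_one.trans (hM1 N)
  have hνM : ∀ N [Fact N.Prime] (x : ZMod N), ν N x ≤ M N := fun N _ x =>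
    le_max_of_le_right (le_ciSup (Finite.bddAbove_range _) x)
  -- the weight `τ`
  set τ : (N : ℕ) → ZMod N → ℝ := fun N x =>
    A * gyWeight K x.valMinAbs.natAbs ^ P + if x = 0 then M N ^ m else 0 with hτ_def
  have hτ0 : ∀ N x, 0 ≤ τ N x := by
    intro N x
    have h1 : 0 ≤ A * gyWeight K x.valMinAbs.natAbs ^ P :=
      mul_nonneg hA0 (pow_nonneg (gyWeight_nonneg _ _) _)
    simp only [hτ_def]
    split_ifs
    · exact add_nonneg h1 (pow_nonneg (hM0 N) _)
    · rw [add_zero]; exact h1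
  refine ⟨τ, hτ0, ?_, ?_⟩
  · ------------------------------------------------------------------ moments
    intro q hq
    obtain ⟨M', hM'0, hM'⟩ := exists_sum_gyWeight_le (K * (P * q))
    have hm0 : (0 : ℝ) < m := by exact_mod_cast (show 0 < m by omega)
    have hq0 : (0 : ℝ) < q := by exact_mod_cast hq
    have hδ : (0 : ℝ) < 1 / (m * q) := by positivity
    refine ⟨2 ^ q * (A ^ q * (2 * M' + 1) + 2 ^ (m * q)), ?_⟩
    filter_upwards [hνg, hsup (1 / (m * q)) hδ, eventually_ge_atTop 1] with N hνgN hsupN hN1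
    intro hprime
    have hN0 : (0 : ℝ) < N := by exact_mod_cast hN1
    rw [expect_zmod_eq_sum_div, div_le_iff₀ hN0]
    -- `M N ≤ 2 N^{1/(mq)}`, so `(M N^m)^q ≤ 2^{mq} N`
    have hMN : M N ≤ 2 * (N : ℝ) ^ (1 / (m * q) : ℝ) := by
      have h1 : (1 : ℝ) ≤ (N : ℝ) ^ (1 / (m * q) : ℝ) :=
        Real.one_le_rpow (by exact_mod_cast hN1) hδ.le
      refine max_le (by linarith) (ciSup_le fun x => ?_)
      calc ν N x ≤ 1 + g N x.val := hνgN x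
        _ ≤ 1 + (N : ℝ) ^ (1 / (m * q) : ℝ) := by linarith [hsupN (x.val : ℤ)]
        _ ≤ 2 * (N : ℝ) ^ (1 / (m * q) : ℝ) := by linarith
    have hMpow : (M N ^ m) ^ q ≤ 2 ^ (m * q) * N := by
      calc (M N ^ m) ^ q = M N ^ (m * q) := (pow_mul _ _ _).symm
        _ ≤ (2 * (N : ℝ) ^ (1 / (m * q) : ℝ)) ^ (m * q) := pow_le_pow_left₀ (hM0 N) hMN _
        _ = 2 ^ (m * q) * ((N : ℝ) ^ (1 / (m * q) : ℝ)) ^ (m * q) := mul_pow _ _ _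
        _ = 2 ^ (m * q) * N := by
            congr 1
            rw [← Real.rpow_natCast, ← Real.rpow_mul hN0.le]
            have : (1 / (m * q) : ℝ) * ((m * q : ℕ) : ℝ) = 1 := by
              push_cast
              field_simp
            rw [this, Real.rpow_one]
    -- the two sums
    have hsumF : ∑ x : ZMod N, gyWeight (K * (P * q)) x.valMinAbs.natAbs ≤ (2 * M' + 1) * N :=
      sum_zmod_gyWeight_le hM' hN1
    have hsumI : ∑ x : ZMod N, (if x = 0 then M N ^ m else (0 : ℝ)) ^ q ≤ 2 ^ (m * q) * N := by
      have : ∀ x : ZMod N, (if x = 0 then M N ^ m else (0 : ℝ)) ^ q =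
          if x = 0 then (M N ^ m) ^ q else 0 := by
        intro x
        split_ifs
        · rfl
        · exact zero_pow (by omega)
      simp_rw [this]
      rw [sum_ite_eq' univ (0 : ZMod N) (fun _ => (M N ^ m) ^ q), if_pos (mem_univ _)]
      exact hMpow
    have hpt : ∀ x : ZMod N, τ N x ^ q ≤ 2 ^ q * (A ^ q * gyWeight (K * (P * q)) x.valMinAbs.natAbs +
        (if x = 0 then M N ^ m else (0 : ℝ)) ^ q) := by
      intro x
      simp only [hτ_def]
      have h1 : 0 ≤ A * gyWeight K x.valMinAbs.natAbs ^ P :=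
        mul_nonneg hA0 (pow_nonneg (gyWeight_nonneg _ _) _)
      have h2 : (0 : ℝ) ≤ if x = 0 then M N ^ m else 0 := by
        split_ifs
        · exact pow_nonneg (hM0 N) _
        · exact le_rfl
      calc (A * gyWeight K x.valMinAbs.natAbs ^ P + if x = 0 then M N ^ m else 0) ^ q
          ≤ 2 ^ q * ((A * gyWeight K x.valMinAbs.natAbs ^ P) ^ q +
              (if x = 0 then M N ^ m else (0 : ℝ)) ^ q) :=
            (add_pow_le h1 h2 q).trans (mul_le_mul_of_nonneg_right
              (pow_le_pow_right₀ one_le_two (Nat.sub_le q 1)) (by positivity))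
        _ = _ := by rw [mul_pow, ← pow_mul, gyWeight_pow]
    calc ∑ x, τ N x ^ q
        ≤ ∑ x : ZMod N, 2 ^ q * (A ^ q * gyWeight (K * (P * q)) x.valMinAbs.natAbs +
            (if x = 0 then M N ^ m else (0 : ℝ)) ^ q) := sum_le_sum fun x _ => hpt x
      _ = 2 ^ q * (A ^ q * ∑ x : ZMod N, gyWeight (K * (P * q)) x.valMinAbs.natAbs +
            ∑ x : ZMod N, (if x = 0 then M N ^ m else (0 : ℝ)) ^ q) := by
          rw [← mul_sum, sum_add_distrib, ← mul_sum]
      _ ≤ 2 ^ q * (A ^ q * ((2 * M' + 1) * N) + 2 ^ (m * q) * N) := by gcongr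
      _ = 2 ^ q * (A ^ q * (2 * M' + 1) + 2 ^ (m * q)) * N := by ring
  · ------------------------------------------------------------------ correlations
    -- the correlation bounds for all `1 ≤ m' ≤ m` with `η = 1`
    have hB : ∀ᶠ N : ℕ in atTop, ∀ m' ∈ Icc 1 m, N.Prime → ∀ h' : Fin m' → ℤ,
        Function.Injective h' → (∀ i, |h' i| ≤ N) → ∑ y ∈ range N, ∏ i, g N (y + h' i) ≤
          2 * N * ∏ p ∈ pairPrimeFactors h', (1 + Cf m' * (p : ℝ) ^ (-(1 / 2 : ℝ))) := by
      refine (Filter.eventually_all_finset (Icc 1 m)).2 fun m' hm' => ?_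
      have h := hCf m' (mem_Icc.1 hm').1 ((mem_Icc.1 hm').2.trans hmm₀) 1 one_pos
      filter_upwards [h] with N hN hNp h' hinj hbdd
      have h2 := hN hNp h' hinj hbdd
      rwa [one_add_one_eq_two] at h2
    filter_upwards [hνg, hB] with N hνgN hBN'
    intro hprime h
    have hBN : ∀ m' ∈ Icc 1 m, ∀ h' : Fin m' → ℤ, Function.Injective h' →
        (∀ i, |h' i| ≤ N) → ∑ y ∈ range N, ∏ i, g N (y + h' i) ≤
          2 * N * ∏ p ∈ pairPrimeFactors h', (1 + Cf m' * (p : ℝ) ^ (-(1 / 2 : ℝ))) :=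
      fun m' hm' => hBN' m' hm' hprime.out
    have hN0 : (0 : ℝ) < N := by exact_mod_cast hprime.out.pos
    -- the symmetric pair weights `G i j` and the target sum
    set G : Fin m → Fin m → ℝ := fun i j => gyWeight K (h i - h j).valMinAbs.natAbs ^ P
      with hG_def
    have hGsymm : ∀ i j, G i j = G j i := by
      intro i j
      simp only [hG_def]
      rw [← neg_sub (h i) (h j), ZMod.natAbs_valMinAbs_neg]
    have hτG : ∑ i, ∑ j with i < j, A * G i j ≤ ∑ i, ∑ j with i < j, τ N (h i - h j) := by
      refine sum_le_sum fun i _ => sum_le_sum fun j _ => ?_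
      simp only [hτ_def, hG_def]
      split_ifs
      · linarith [pow_nonneg (hM0 N) m]
      · linarith
    by_cases hinj : Function.Injective h
    swap
    · ---------------------------------------------------------------- coincident shifts
      obtain ⟨i, j, hij, hne⟩ := Function.not_injective_iff.1 hinj
      have hE : 𝔼 x, ∏ k, ν N (x + h k) ≤ M N ^ m := by
        rw [expect_zmod_eq_sum_div, div_le_iff₀ hN0]
        calc ∑ x, ∏ k, ν N (x + h k) ≤ ∑ _x : ZMod N, M N ^ m := by
              refine sum_le_sum fun x _ => ?_
              calc ∏ k, ν N (x + h k) ≤ ∏ _k : Fin m, M N :=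
                    prod_le_prod (fun k _ => hν0 _ _) (fun k _ => hνM N _)
                _ = M N ^ m := by rw [prod_const, card_univ, Fintype.card_fin]
          _ = M N ^ m * N := by rw [sum_const, card_univ, ZMod.card, nsmul_eq_mul]; ring
      have hτ00 : M N ^ m ≤ τ N 0 := by
        simp only [hτ_def, if_true]
        linarith [mul_nonneg hA0 (pow_nonneg (gyWeight_nonneg K (0 : ZMod N).valMinAbs.natAbs) P)]
      have hpair : ∀ i' j' : Fin m, i' < j' → h i' = h j' →
          𝔼 x, ∏ k, ν N (x + h k) ≤ ∑ i, ∑ j with i < j, τ N (h i - h j) := by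
        intro i' j' hlt heq
        calc 𝔼 x, ∏ k, ν N (x + h k) ≤ M N ^ m := hE
          _ ≤ τ N (h i' - h j') := by rw [heq, sub_self]; exact hτ00
          _ ≤ ∑ j with i' < j, τ N (h i' - h j) :=
              single_le_sum (f := fun j => τ N (h i' - h j)) (fun _ _ => hτ0 _ _)
                (mem_filter.2 ⟨mem_univ _, hlt⟩)
          _ ≤ ∑ i, ∑ j with i < j, τ N (h i - h j) :=
              single_le_sum (f := fun i => ∑ j with i < j, τ N (h i - h j))
                (fun _ _ => sum_nonneg fun _ _ => hτ0 _ _) (mem_univ i')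
      rcases lt_or_gt_of_ne hne with hlt | hlt
      · exact hpair i j hlt hij
      · exact hpair j i hlt hij.symm
    · ---------------------------------------------------------------- distinct shifts
      set c : Fin m → ℕ := fun i => (h i).val with hc_def
      have hcN : ∀ i, c i < N := fun i => ZMod.val_lt _
      have hch : ∀ i, ((c i : ℕ) : ZMod N) = h i := fun i => ZMod.natCast_zmod_val _
      have hgN : ∀ n, g N n ≠ 0 → 0 ≤ n ∧ n < (N : ℤ) := by
        intro n hn
        obtain ⟨h1, h2⟩ := hsupp N n hn
        have hεN : 0 ≤ ε₀ * N := by linarith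
        have hε₀ : 0 ≤ ε₀ := nonneg_of_mul_nonneg_left hεN hN0 |> fun h => by
          rcases (mul_nonneg_iff.1 hεN) with ⟨ha, -⟩ | ⟨-, hb⟩
          · exact ha
          · linarith
        constructor
        · have : (0 : ℝ) ≤ n := hεN.trans h1
          exact_mod_cast this
        · have : (n : ℝ) < N := by nlinarith
          exact_mod_cast this
      set SG : ℝ := ∑ ij ∈ (univ : Finset (Fin m)).offDiag, G ij.1 ij.2 with hSG_def
      -- Step 1: `ν ≤ 1 + g`
      have h1 : 𝔼 x, ∏ i, ν N (x + h i) ≤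
          (∑ x : ZMod N, ∏ i, (1 + g N ((x + h i).val : ℕ))) / N := by
        rw [← expect_zmod_eq_sum_div]
        exact expect_le_expect fun x _ => prod_le_prod (fun i _ => hν0 _ _) (fun i _ => hνgN _)
      -- Step 2: expand the product over subsets `S` and pass to representatives `y < N`
      have h2 : ∑ x : ZMod N, ∏ i, (1 + g N ((x + h i).val : ℕ)) =
          ∑ S ∈ (univ : Finset (Fin m)).powerset,
            ∑ y ∈ range N, ∏ i ∈ S, g N (((y + c i) % N : ℕ)) := by
        calc ∑ x : ZMod N, ∏ i, (1 + g N ((x + h i).val : ℕ))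
            = ∑ x : ZMod N, ∑ S ∈ (univ : Finset (Fin m)).powerset,
                ∏ i ∈ S, g N ((x + h i).val : ℕ) := sum_congr rfl fun x _ => prod_one_add _
          _ = ∑ S ∈ (univ : Finset (Fin m)).powerset, ∑ x : ZMod N,
                ∏ i ∈ S, g N ((x + h i).val : ℕ) := sum_comm
          _ = _ := by
              refine sum_congr rfl fun S _ => ?_
              have : ∀ x : ZMod N, ∏ i ∈ S, g N ((x + h i).val : ℕ) =
                  ∏ i ∈ S, g N (((x.val + c i) % N : ℕ)) := by
                intro x
                exact prod_congr rfl fun i _ => by rw [ZMod.val_add]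
              simp_rw [this]
              exact sum_zmod_eq_sum_range (fun y => ∏ i ∈ S, g N (((y + c i) % N : ℕ)))
      -- Step 3: for each `S`, split by wrap-around (`B ⊆ S`) and apply the key step
      have h3 : ∀ S ∈ (univ : Finset (Fin m)).powerset,
          ∑ y ∈ range N, ∏ i ∈ S, g N (((y + c i) % N : ℕ)) ≤ 2 ^ #S * (4 * N * SG) := by
        intro S _
        have hsplit : ∀ y ∈ range N, ∏ i ∈ S, g N (((y + c i) % N : ℕ)) =
            ∑ B ∈ S.powerset, ∏ i ∈ S, g N (y + ((c i : ℤ) - if i ∈ B then 0 else (N : ℤ))) := by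
          intro y hy
          rw [prod_congr rfl fun i _ => apply_mod_eq_add_of_support hgN (mem_range.1 hy) (hcN i),
            prod_add]
          refine sum_congr rfl fun B hB => ?_
          rw [← prod_sdiff (mem_powerset.1 hB), mul_comm]
          refine congrArg₂ (· * ·) (prod_congr rfl fun i hi => ?_) (prod_congr rfl fun i hi => ?_)
          · rw [if_neg (mem_sdiff.1 hi).2]; congr 1; ring
          · rw [if_pos hi, sub_zero]
        rw [sum_congr rfl hsplit, sum_comm]
        have hkey : ∀ B ∈ S.powerset, ∑ y ∈ range N,
            ∏ i ∈ S, g N (y + ((c i : ℤ) - if i ∈ B then 0 else (N : ℤ))) ≤ 4 * N * SG := by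
          intro B _
          refine sum_prod_shift_le hε₁ (hsupp N) Cf
            (fun m' h1 h2 => hCf0 m' h1 (h2.trans hmm₀))
            (fun m' h1 h2 => hCfK m' h1 (h2.trans hmm₀)) (hBN) (by omega) le_rfl h S
            (fun i => (c i : ℤ) - if i ∈ B then 0 else (N : ℤ)) ?_ ?_ ?_
          · intro i _ j _ hd
            have hc' : (c i : ℤ) - c j =
                (if i ∈ B then 0 else (N : ℤ)) - (if j ∈ B then 0 else (N : ℤ)) := by
              simp only at hd; linarith
            have hci := hcN i
            have hcj := hcN j
            have hcc : c i = c j := by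
              split_ifs at hc' <;> omega
            exact hinj ((ZMod.val_injective N) hcc)
          · intro i _
            have hci := hcN i
            split_ifs
            · rw [sub_zero, Nat.abs_cast]; exact_mod_cast hci.le
            · rw [abs_sub_comm, abs_of_nonneg (by omega)]
              linarith
          · intro i _
            split_ifs
            · simp [hch i]
            · push_cast
              rw [ZMod.natCast_self, sub_zero, hch i]
        calc ∑ B ∈ S.powerset, ∑ y ∈ range N,
              ∏ i ∈ S, g N (y + ((c i : ℤ) - if i ∈ B then 0 else (N : ℤ)))
            ≤ ∑ _B ∈ S.powerset, 4 * N * SG := sum_le_sum hkey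
          _ = 2 ^ #S * (4 * N * SG) := by
              rw [sum_const, card_powerset, nsmul_eq_mul]; push_cast; ring
      -- Step 4: `∑_S 2^{#S} = 3^m`
      have h4 : ∑ S ∈ (univ : Finset (Fin m)).powerset, (2 : ℝ) ^ #S * (4 * N * SG) =
          3 ^ m * (4 * N * SG) := by
        rw [← sum_mul]
        congr 1
        have := sum_pow_mul_eq_add_pow (2 : ℝ) 1 (univ : Finset (Fin m))
        simp only [one_pow, mul_one, card_univ, Fintype.card_fin] at this
        rw [this]; norm_num
      -- Step 5: `∑_{i ≠ j} G = 2 ∑_{i < j} G`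
      have h5 : SG = 2 * ∑ i, ∑ j with i < j, G i j := sum_offDiag_eq_two_mul_of_symm G hGsymm
      calc 𝔼 x, ∏ i, ν N (x + h i)
          ≤ (∑ x : ZMod N, ∏ i, (1 + g N ((x + h i).val : ℕ))) / N := h1
        _ = (∑ S ∈ (univ : Finset (Fin m)).powerset,
              ∑ y ∈ range N, ∏ i ∈ S, g N (((y + c i) % N : ℕ))) / N := by rw [h2]
        _ ≤ (∑ S ∈ (univ : Finset (Fin m)).powerset, (2 : ℝ) ^ #S * (4 * N * SG)) / N := by
            gcongr with S hS
            exact h3 S hS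
        _ = 3 ^ m * 4 * SG := by rw [h4]; field_simp
        _ = ∑ i, ∑ j with i < j, A * G i j := by
            rw [h5, hA_def]; simp_rw [← mul_sum]; ring
        _ ≤ ∑ i, ∑ j with i < j, τ N (h i - h j) := hτG


/-! ### Proposition 9.10 for the measure of Definition 9.3, from Proposition 9.6 -/

/-- `|Λ_R(n)| ≤ d(|n|) log R` for `R ≥ 1`, `n ≠ 0` (each of the at most `d(|n|)` terms has
`|μ(d)| ≤ 1` and `0 ≤ log(R/d) ≤ log R`). [cite: GreenTaoAnnals2008, Definition 9.2] -/
theorem abs_truncatedDivisorSum_le {R : ℝ} (hR : 1 ≤ R) {n : ℤ} (hn : n ≠ 0) :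
    |truncatedDivisorSum R n| ≤ #(n.natAbs.divisors) * Real.log R := by
  classical
  rw [truncatedDivisorSum_def]
  have hR0 : 0 < R := by linarith
  set F := (Icc 1 ⌊R⌋₊).filter (fun d : ℕ => (d : ℤ) ∣ n) with hF
  calc |∑ d ∈ F, (ArithmeticFunction.moebius d : ℝ) * Real.log (R / d)|
      ≤ ∑ d ∈ F, |(ArithmeticFunction.moebius d : ℝ) * Real.log (R / d)| := abs_sum_le_sum_abs _ _
    _ ≤ ∑ _d ∈ F, Real.log R := by
        refine sum_le_sum fun d hd => ?_
        obtain ⟨hd', -⟩ := mem_filter.1 hd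
        obtain ⟨h1, h2⟩ := mem_Icc.1 hd'
        have hd0 : (0 : ℝ) < d := by exact_mod_cast h1
        have hdR : (d : ℝ) ≤ R := (show (d : ℝ) ≤ ⌊R⌋₊ by exact_mod_cast h2).trans (Nat.floor_le hR0.le)
        have hμ : |(ArithmeticFunction.moebius d : ℝ)| ≤ 1 := by
          exact_mod_cast ArithmeticFunction.abs_moebius_le_one
        have hlog0 : 0 ≤ Real.log (R / d) := Real.log_nonneg ((one_le_div hd0).2 hdR)
        have hlog1 : Real.log (R / d) ≤ Real.log R := by
          rw [Real.log_div hR0.ne' hd0.ne']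
          linarith [Real.log_nonneg (show (1 : ℝ) ≤ d by exact_mod_cast h1)]
        rw [abs_mul, abs_of_nonneg hlog0]
        calc |(ArithmeticFunction.moebius d : ℝ)| * Real.log (R / d) ≤ 1 * Real.log R :=
              mul_le_mul hμ hlog1 hlog0 zero_le_one
          _ = Real.log R := one_mul _
    _ = #F * Real.log R := by rw [sum_const, nsmul_eq_mul]
    _ ≤ #(n.natAbs.divisors) * Real.log R := by
        have hsub : F ⊆ n.natAbs.divisors := fun d hd => by
          obtain ⟨-, hdn⟩ := mem_filter.1 hd
          exact Nat.mem_divisors.2 ⟨Int.natCast_dvd.1 hdn, Int.natAbs_ne_zero.2 hn⟩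
        have := card_le_card hsub
        have hlogR : 0 ≤ Real.log R := Real.log_nonneg hR
        gcongr

/-- `R^{10 m} ≤ N` for `m ≤ 2^{k-1}`, `k ≥ 1`, `N ≥ 1` (`R = N^{k⁻¹2^{-k-4}}`, and
`10 · 2^{k-1} ≤ k · 2^{k+4}`): the interval `[0, N)` is long enough for Proposition 9.6.
[cite: GreenTaoAnnals2008, Proposition 9.10 (proof)] -/
theorem gyLevel_pow_le {k m N : ℕ} (hk : 1 ≤ k) (hm : m ≤ 2 ^ (k - 1)) (hN : 1 ≤ N) :
    gyLevel k N ^ (10 * m) ≤ N := by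
  have hN1 : (1 : ℝ) ≤ N := by exact_mod_cast hN
  have hnat : 10 * m ≤ k * 2 ^ (k + 4) := by
    have h2 : 2 ^ (k + 4) = 2 ^ (k - 1) * 32 := by
      rw [show k + 4 = (k - 1) + 5 by omega, pow_add]; norm_num
    calc 10 * m ≤ 10 * 2 ^ (k - 1) := by omega
      _ ≤ 1 * (2 ^ (k - 1) * 32) := by omega
      _ ≤ k * (2 ^ (k - 1) * 32) := Nat.mul_le_mul_right _ hk
      _ = k * 2 ^ (k + 4) := by rw [h2]
  have hk0 : (0 : ℝ) < k := by exact_mod_cast hk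
  have hexp : (k : ℝ)⁻¹ * 2⁻¹ ^ (k + 4) * ((10 * m : ℕ) : ℝ) ≤ 1 := by
    have hpos : (0 : ℝ) < k * 2 ^ (k + 4) := by positivity
    have hle : ((10 * m : ℕ) : ℝ) ≤ (k : ℝ) * 2 ^ (k + 4) := by exact_mod_cast hnat
    calc (k : ℝ)⁻¹ * 2⁻¹ ^ (k + 4) * ((10 * m : ℕ) : ℝ)
        = ((10 * m : ℕ) : ℝ) / ((k : ℝ) * 2 ^ (k + 4)) := by
          rw [inv_pow]
          field_simp
      _ ≤ 1 := (div_le_one hpos).2 hle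
  calc gyLevel k N ^ (10 * m) = (N : ℝ) ^ ((k : ℝ)⁻¹ * 2⁻¹ ^ (k + 4) * ((10 * m : ℕ) : ℝ)) := by
        rw [gyLevel_def, ← Real.rpow_natCast, ← Real.rpow_mul (by positivity)]
    _ ≤ (N : ℝ) ^ (1 : ℝ) := Real.rpow_le_rpow_of_exponent_le hN1 hexp
    _ = N := Real.rpow_one _

/-- **Green–Tao 2008, Proposition 9.10** ("The measure `ν` satisfies the `2^{k-1}`-correlation
condition"), derived from Proposition 9.6 (`GoldstonYildirimCorrelations`) exactly as printed
(pp. 529–530, with Lemma 9.9), via `correlationCondition_of_shiftBound` applied to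
`g_N(n) = (φ(W)/W) Λ_R(W n + 1)² / log R · 1_{[ε_k N, 2ε_k N]}(n)`. The growth bound is
`G = min(min_{1 ≤ m ≤ 2^{k-1}} G_{9.6}(k, m), ⌊log_4 log N⌋)`; the `L^∞` bound
`‖ν_N‖_∞ ≤ N^{o(1)}` comes from `|Λ_R(n)| ≤ d(n) log R` and the divisor bound `d(n) ≪_ε n^ε`
(`Literature.NumberTheory.Sieve.exists_card_divisors_le_mul_rpow`, Hardy–Wright Thm 315) in place of the maximal-order
bound quoted on p. 529. [cite: GreenTaoAnnals2008, Proposition 9.10] -/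
theorem MeasureCorrelation_of (h96 : GoldstonYildirimCorrelations) : MeasureCorrelation := by
  classical
  intro k hk
  have hk1 : 1 ≤ k := by omega
  choose! C hC0 G hG H using fun m hm => h96 k m hk hm
  set m₀ : ℕ := 2 ^ (k - 1) with hm₀_def
  have hm₀1 : 1 ≤ m₀ := Nat.one_le_two_pow
  have hne : (Icc 1 m₀).Nonempty := ⟨1, mem_Icc.2 ⟨le_rfl, hm₀1⟩⟩
  set Gmin : ℕ → ℕ := fun N => (Icc 1 m₀).inf' hne (fun m => G m N) with hGmin_def
  have hGmin : Tendsto Gmin atTop atTop := by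
    rw [Filter.tendsto_atTop]
    intro b
    have hall : ∀ᶠ N in atTop, ∀ m ∈ Icc 1 m₀, b ≤ G m N :=
      (Filter.eventually_all_finset _).2 fun m hm =>
        Filter.tendsto_atTop.1 (hG m (mem_Icc.1 hm).1) b
    filter_upwards [hall] with N hN
    exact Finset.le_inf' _ _ hN
  have hGminle : ∀ m ∈ Icc 1 m₀, ∀ N, Gmin N ≤ G m N := fun m hm N => Finset.inf'_le _ hm
  have hfl : Tendsto (fun N : ℕ => ⌊Real.logb 4 (Real.log N)⌋₊) atTop atTop :=
    tendsto_nat_floor_atTop.comp ((Real.tendsto_logb_atTop (by norm_num)).comp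
      (Real.tendsto_log_atTop.comp tendsto_natCast_atTop_atTop))
  refine ⟨fun N => min (Gmin N) ⌊Real.logb 4 (Real.log N)⌋₊, tendsto_inf_atTop atTop hGmin hfl,
    fun w hw hwG => ?_⟩
  have hwG' : ∀ m ∈ Icc 1 m₀, ∀ N, w N ≤ G m N := fun m hm N =>
    (hwG N).trans ((min_le_left _ _).trans (hGminle m hm N))
  have hwlog : ∀ N, w N ≤ ⌊Real.logb 4 (Real.log N)⌋₊ := fun N => (hwG N).trans (min_le_right _ _)
  -- the function `g_N`
  set g : ℕ → ℤ → ℝ := fun N n =>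
    if eps k * N ≤ (n : ℝ) ∧ (n : ℝ) ≤ 2 * eps k * N then
      (Nat.totient (primorial (w N)) : ℝ) / primorial (w N) *
        truncatedDivisorSum (gyLevel k N) (primorial (w N) * n + 1) ^ 2 / Real.log (gyLevel k N)
    else 0 with hg_def
  have hg0 : ∀ N n, 0 ≤ g N n := by
    intro N n
    simp only [hg_def]
    split_ifs
    · exact div_nonneg (mul_nonneg (div_nonneg (Nat.cast_nonneg _) (Nat.cast_nonneg _))
        (sq_nonneg _)) (log_gyLevel_nonneg k N)
    · exact le_rfl
  have hε : eps k < 1 / 4 := by linarith [eps_le k]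
  -- shared eventualities
  have hlogR1 : ∀ᶠ N : ℕ in atTop, 1 ≤ Real.log (gyLevel k N) := by
    have hc : 0 < (k : ℝ)⁻¹ * 2⁻¹ ^ (k + 4) := by
      have : (0 : ℝ) < k := by exact_mod_cast hk1
      positivity
    have ht : Tendsto (fun N : ℕ => Real.log (gyLevel k N)) atTop atTop := by
      simp_rw [log_gyLevel]
      exact Tendsto.const_mul_atTop hc (Real.tendsto_log_atTop.comp tendsto_natCast_atTop_atTop)
    exact ht.eventually_ge_atTop 1
  have hWN : ∀ᶠ N : ℕ in atTop, (primorial (w N) : ℝ) ≤ N := by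
    filter_upwards [eventually_ge_atTop 3] with N hN3
    have hN3' : (3 : ℝ) ≤ N := by exact_mod_cast hN3
    exact (primorial_le_log hN3 (hwlog N)).trans
      ((Real.log_le_sub_one_of_pos (by linarith)).trans (by linarith))
  refine correlationCondition_of_shiftBound g hε (gtMeasure_nonneg k w)
    (Filter.Eventually.of_forall ?_) ?_ ?_ ?_
  · ---------------------------------------------------------------- `ν ≤ 1 + g`
    intro N x
    simp only [gtMeasure, hg_def, Int.cast_natCast]
    split_ifs
    · linarith
    · norm_num
  · ---------------------------------------------------------------- support of `g`
    intro N n hn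
    simp only [hg_def] at hn
    split_ifs at hn with hc
    · exact hc
    · exact absurd rfl hn
  · ---------------------------------------------------------------- `‖g_N‖_∞ ≤ N^δ`
    intro δ hδ
    have hδ' : 0 < δ / 16 := by positivity
    obtain ⟨C₁, hC₁, hd⟩ := Literature.NumberTheory.Sieve.exists_card_divisors_le_mul_rpow hδ'
    have e2 : ∀ᶠ N : ℕ in atTop, Real.log N ≤ (N : ℝ) ^ (δ / 16) := by
      have h := (isLittleO_log_rpow_atTop hδ').bound (show (0 : ℝ) < 1 by norm_num)
      filter_upwards [tendsto_natCast_atTop_atTop.eventually h, eventually_ge_atTop 1] with N hN hN1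
      rw [one_mul, Real.norm_eq_abs, Real.norm_eq_abs,
        abs_of_nonneg (Real.log_nonneg (by exact_mod_cast hN1)), abs_of_nonneg (by positivity)] at hN
      exact hN
    have e3 : ∀ᶠ N : ℕ in atTop, C₁ ^ 2 ≤ (N : ℝ) ^ (δ / 2) :=
      ((tendsto_rpow_atTop (show 0 < δ / 2 by positivity)).comp
        tendsto_natCast_atTop_atTop).eventually_ge_atTop _
    filter_upwards [hlogR1, e2, e3, hWN, eventually_ge_atTop 2] with N h1 h2 h3 h4 hN2 n
    simp only [hg_def]
    split_ifs with hc
    swap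
    · positivity
    obtain ⟨hc1, hc2⟩ := hc
    have hN0 : (0 : ℝ) < N := by exact_mod_cast (show 0 < N by omega)
    have hN1 : (1 : ℝ) ≤ N := by exact_mod_cast (show 1 ≤ N by omega)
    have hn0 : (0 : ℝ) ≤ n := le_trans (mul_nonneg (eps_pos k).le hN0.le) hc1
    have hnN : (n : ℝ) ≤ N := by
      have := two_mul_eps_lt_one k
      calc (n : ℝ) ≤ 2 * eps k * N := hc2
        _ ≤ 1 * N := by gcongr
        _ = N := one_mul _
    have hn0' : (0 : ℤ) ≤ n := by exact_mod_cast hn0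
    set W : ℕ := primorial (w N) with hW_def
    set n' : ℤ := (W : ℤ) * n + 1 with hn'_def
    have hW1 : (1 : ℤ) ≤ W := by exact_mod_cast primorial_pos (w N)
    have hn'1 : 1 ≤ n' := by
      have : 0 ≤ (W : ℤ) * n := mul_nonneg (by linarith) hn0'
      linarith
    have hn'0 : n' ≠ 0 := by linarith
    -- `|n'| ≤ N³`
    have hn'le : ((n'.natAbs : ℕ) : ℝ) ≤ (N : ℝ) ^ (3 : ℕ) := by
      have habs : ((n'.natAbs : ℕ) : ℝ) = ((n' : ℤ) : ℝ) := by
        rw [Nat.cast_natAbs, Int.cast_abs, abs_of_pos (by exact_mod_cast hn'1)]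
      rw [habs, hn'_def]
      push_cast
      have h2N : (2 : ℝ) ≤ N := by exact_mod_cast hN2
      nlinarith [mul_le_mul h4 hnN hn0 hN0.le]
    -- `|Λ_R(n')| ≤ d(n') log R ≤ C₁ N^{3δ/16} N^{δ/16}`
    have hR1 : 1 ≤ gyLevel k N := one_le_gyLevel (by omega)
    have hR0 : 0 < gyLevel k N := by linarith
    have hlogR : Real.log (gyLevel k N) ≤ Real.log N := by
      apply Real.log_le_log hR0
      calc gyLevel k N = (N : ℝ) ^ ((k : ℝ)⁻¹ * 2⁻¹ ^ (k + 4)) := rfl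
        _ ≤ (N : ℝ) ^ (1 : ℝ) := by
            apply Real.rpow_le_rpow_of_exponent_le hN1
            have h1 : (k : ℝ)⁻¹ ≤ 1 := inv_le_one_of_one_le₀ (by exact_mod_cast hk1)
            have h2 : (2⁻¹ : ℝ) ^ (k + 4) ≤ 1 := pow_le_one₀ (by norm_num) (by norm_num)
            exact mul_le_one₀ h1 (by positivity) h2
        _ = N := Real.rpow_one _
    have hΛ := abs_truncatedDivisorSum_le hR1 hn'0
    have hdiv := hd n'.natAbs (Int.natAbs_ne_zero.2 hn'0)
    have hD : (#(n'.natAbs.divisors) : ℝ) ≤ C₁ * (N : ℝ) ^ (3 * (δ / 16)) := by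
      calc (#(n'.natAbs.divisors) : ℝ) ≤ C₁ * ((n'.natAbs : ℕ) : ℝ) ^ (δ / 16) := hdiv
        _ ≤ C₁ * ((N : ℝ) ^ (3 : ℕ)) ^ (δ / 16) := by gcongr
        _ = C₁ * (N : ℝ) ^ (3 * (δ / 16)) := by
            rw [← Real.rpow_natCast, ← Real.rpow_mul hN0.le]; norm_num
    have hΛ' : |truncatedDivisorSum (gyLevel k N) n'| ≤ C₁ * (N : ℝ) ^ (4 * (δ / 16)) := by
      calc |truncatedDivisorSum (gyLevel k N) n'| ≤ #(n'.natAbs.divisors) * Real.log (gyLevel k N) := hΛ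
        _ ≤ (C₁ * (N : ℝ) ^ (3 * (δ / 16))) * (N : ℝ) ^ (δ / 16) :=
            mul_le_mul hD (hlogR.trans h2) (by linarith) (by positivity)
        _ = C₁ * (N : ℝ) ^ (4 * (δ / 16)) := by
            rw [show 4 * (δ / 16) = 3 * (δ / 16) + δ / 16 by ring, Real.rpow_add hN0]; ring
    have hΛ2 : truncatedDivisorSum (gyLevel k N) n' ^ 2 ≤ C₁ ^ 2 * (N : ℝ) ^ (δ / 2) := by
      calc truncatedDivisorSum (gyLevel k N) n' ^ 2 = |truncatedDivisorSum (gyLevel k N) n'| ^ 2 :=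
            (sq_abs _).symm
        _ ≤ (C₁ * (N : ℝ) ^ (4 * (δ / 16))) ^ 2 := pow_le_pow_left₀ (abs_nonneg _) hΛ' 2
        _ = C₁ ^ 2 * ((N : ℝ) ^ (4 * (δ / 16))) ^ 2 := mul_pow _ _ _
        _ = C₁ ^ 2 * (N : ℝ) ^ (δ / 2) := by
            congr 1
            rw [← Real.rpow_natCast, ← Real.rpow_mul hN0.le]
            ring_nf
    -- assemble
    have hφW : (Nat.totient W : ℝ) / W ≤ 1 :=
      div_le_one_of_le₀ (by exact_mod_cast Nat.totient_le W) (Nat.cast_nonneg _)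
    calc (Nat.totient W : ℝ) / W * truncatedDivisorSum (gyLevel k N) n' ^ 2 / Real.log (gyLevel k N)
        ≤ 1 * truncatedDivisorSum (gyLevel k N) n' ^ 2 / 1 := by gcongr
      _ = truncatedDivisorSum (gyLevel k N) n' ^ 2 := by ring
      _ ≤ C₁ ^ 2 * (N : ℝ) ^ (δ / 2) := hΛ2
      _ ≤ (N : ℝ) ^ (δ / 2) * (N : ℝ) ^ (δ / 2) := by gcongr
      _ = (N : ℝ) ^ δ := by rw [← Real.rpow_add hN0]; ring_nf
  · ---------------------------------------------------------------- Prop 9.6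
    intro m hm1 hm2
    refine ⟨C m, hC0 m hm1, fun η hη => ?_⟩
    have hev := H m hm1 w hw (hwG' m (mem_Icc.2 ⟨hm1, hm2⟩)) η hη
    filter_upwards [hev, hlogR1, eventually_ge_atTop 1] with N hN hlogR hN1 hNp h hinj hbdd
    have hN0 : (0 : ℝ) < N := by exact_mod_cast hN1
    set W : ℕ := primorial (w N) with hW_def
    set R : ℝ := gyLevel k N with hR_def
    have hW0 : (0 : ℝ) < W := by exact_mod_cast primorial_pos (w N)
    have hφ0 : (0 : ℝ) < Nat.totient W := by exact_mod_cast Nat.totient_pos.2 (primorial_pos (w N))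
    have hlogR0 : 0 < Real.log R := by simp only [hR_def]; linarith
    set cN : ℝ := (Nat.totient W : ℝ) / W / Real.log R with hcN_def
    have hcN0 : 0 ≤ cN := by positivity
    have hgle : ∀ z : ℤ, g N z ≤ cN * truncatedDivisorSum R ((W : ℤ) * z + 1) ^ 2 := by
      intro z
      simp only [hg_def]
      split_ifs
      · apply le_of_eq
        simp only [hcN_def, hW_def, hR_def]
        ring
      · positivity
    -- Proposition 9.6 on the interval `[0, N)`
    have hRN : gyLevel k N ^ (10 * m) ≤ N := gyLevel_pow_le hk1 hm2 hN1
    have h96N := hN hNp h hinj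
      (fun i => (hbdd i).trans (by exact_mod_cast Nat.le_self_pow two_ne_zero N)) 0 N hRN
    rw [zero_add, expect_eq_sum_div_card, Int.card_Ico, sub_zero, Int.toNat_natCast,
      div_le_iff₀ hN0] at h96N
    -- the prime factors of `Δ` are among the `pairPrimeFactors`
    have hsub : (∏ i, ∏ j ∈ univ.filter (fun j => i < j), |h i - h j|).natAbs.primeFactors ⊆
        pairPrimeFactors h := by
      intro p hp
      obtain ⟨hpp, hpd, -⟩ := Nat.mem_primeFactors.1 hp
      have hpz : Prime (p : ℤ) := Nat.prime_iff_prime_int.1 hpp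
      have h1 : (p : ℤ) ∣ ∏ i, ∏ j ∈ univ.filter (fun j => i < j), |h i - h j| :=
        Int.natCast_dvd.2 hpd
      obtain ⟨i, -, hi⟩ := (hpz.dvd_finsetProd_iff _).1 h1
      obtain ⟨j, hj, hij⟩ := (hpz.dvd_finsetProd_iff _).1 hi
      have hlt : i < j := (mem_filter.1 hj).2
      rw [pairPrimeFactors_def, mem_biUnion]
      refine ⟨(i, j), mem_univ _, Nat.mem_primeFactors.2 ⟨hpp, ?_, ?_⟩⟩
      · exact Int.natCast_dvd.1 ((dvd_abs _ _).1 hij)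
      · exact Int.natAbs_ne_zero.2 (sub_ne_zero.2 fun heq => hlt.ne (hinj heq))
    calc ∑ y ∈ range N, ∏ i, g N (y + h i)
        ≤ ∑ y ∈ range N, ∏ i, cN * truncatedDivisorSum R ((W : ℤ) * (y + h i) + 1) ^ 2 :=
          sum_le_sum fun y _ => prod_le_prod (fun i _ => hg0 N _) (fun i _ => hgle _)
      _ = cN ^ m * ∑ y ∈ range N, ∏ i, truncatedDivisorSum R ((W : ℤ) * (y + h i) + 1) ^ 2 := by
          rw [mul_sum]
          refine sum_congr rfl fun y _ => ?_
          rw [prod_mul_distrib, prod_const, card_univ, Fintype.card_fin]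
      _ = cN ^ m * ∑ x ∈ Ico (0 : ℤ) N, ∏ i, truncatedDivisorSum R ((W : ℤ) * (x + h i) + 1) ^ 2 := by
          congr 1
          refine sum_nbij (fun y : ℕ => (y : ℤ)) (fun y hy => mem_Ico.2 ⟨by positivity, ?_⟩)
            (fun a _ b _ hab => Nat.cast_injective hab) (fun x hx => ?_) (fun y _ => rfl)
          · exact_mod_cast mem_range.1 hy
          · obtain ⟨h0, h1⟩ := mem_Ico.1 (mem_coe.1 hx)
            refine ⟨x.toNat, mem_coe.2 (mem_range.2 ?_), Int.toNat_of_nonneg h0⟩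
            omega
      _ ≤ cN ^ m * ((1 + η) * ((W : ℝ) * Real.log R / Nat.totient W) ^ m *
            (∏ p ∈ (∏ i, ∏ j ∈ univ.filter (fun j => i < j), |h i - h j|).natAbs.primeFactors,
              (1 + C m * (p : ℝ) ^ (-(1 / 2 : ℝ)))) * N) := by
          gcongr
      _ = (1 + η) * N * ∏ p ∈ (∏ i, ∏ j ∈ univ.filter (fun j => i < j), |h i - h j|).natAbs.primeFactors,
              (1 + C m * (p : ℝ) ^ (-(1 / 2 : ℝ))) := by
          have hone : cN * ((W : ℝ) * Real.log R / Nat.totient W) = 1 := by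
            simp only [hcN_def]
            field_simp
          calc cN ^ m * ((1 + η) * ((W : ℝ) * Real.log R / Nat.totient W) ^ m *
                (∏ p ∈ (∏ i, ∏ j ∈ univ.filter (fun j => i < j), |h i - h j|).natAbs.primeFactors,
                  (1 + C m * (p : ℝ) ^ (-(1 / 2 : ℝ)))) * N)
              = (cN * ((W : ℝ) * Real.log R / Nat.totient W)) ^ m * ((1 + η) * N *
                  ∏ p ∈ (∏ i, ∏ j ∈ univ.filter (fun j => i < j), |h i - h j|).natAbs.primeFactors,
                    (1 + C m * (p : ℝ) ^ (-(1 / 2 : ℝ)))) := by ring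
            _ = _ := by rw [hone, one_pow, one_mul]
      _ ≤ (1 + η) * N * ∏ p ∈ pairPrimeFactors h, (1 + C m * (p : ℝ) ^ (-(1 / 2 : ℝ))) := by
          have hC := hC0 m hm1
          gcongr (1 + η) * N * ?_
          exact prod_le_prod_of_subset_of_one_le hsub (fun p _ => by positivity)
            (fun p _ _ => le_add_of_nonneg_right (by positivity))


/-! ### Bridge to the Goldston–Pintz–Yıldırım file -/

/-- For `n ≥ 1`, Green–Tao's truncated divisor sum `Λ_R(n)` (Definition 9.2) is the
Goldston–Pintz–Yıldırım `Λ_R(n; {0}, 0)` of the tree (`Literature.NumberTheory.Sieve.GPY.lambdaR`, GPY (2.13) with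
`H = {0}`, `k = 1`, `ℓ = 0`: `P_{{0}}(n) = n`, `(1/1!) ∑_{d ∣ n, d ≤ R} μ(d) log(R/d)`).
[cite: GreenTaoAnnals2008, Definition 9.2] -/
theorem truncatedDivisorSum_eq_lambdaR (R : ℝ) {n : ℕ} (hn : 1 ≤ n) :
    truncatedDivisorSum R n = Literature.NumberTheory.Sieve.GPY.lambdaR R {0} 0 n := by
  classical
  unfold Literature.NumberTheory.Sieve.GPY.lambdaR Literature.NumberTheory.Sieve.GPY.tuplePoly
  rw [truncatedDivisorSum_def]
  simp only [Finset.prod_singleton, add_zero, Finset.card_singleton, Nat.factorial_one,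
    Nat.cast_one, inv_one, one_mul, pow_one]
  refine Finset.sum_congr ?_ fun d _ => rfl
  ext d
  simp only [mem_filter, mem_Icc, Nat.mem_divisors]
  constructor
  · rintro ⟨⟨h1, h2⟩, hd⟩
    have hR0 : 0 ≤ R := by
      by_contra hneg
      push Not at hneg
      have : ⌊R⌋₊ = 0 := Nat.floor_of_nonpos hneg.le
      omega
    exact ⟨⟨Int.natCast_dvd_natCast.1 hd, by omega⟩,
      (show (d : ℝ) ≤ ⌊R⌋₊ by exact_mod_cast h2).trans (Nat.floor_le hR0)⟩
  · rintro ⟨⟨hd, -⟩, hdR⟩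
    have hd1 : 1 ≤ d := Nat.pos_of_dvd_of_pos hd hn
    exact ⟨⟨hd1, Nat.le_floor hdR⟩, Int.natCast_dvd_natCast.2 hd⟩


/-! ### Proposition 9.10 discharged: `MeasureCorrelation` holds

Green–Tao's proof of Proposition 9.10 (formalised above as `correlationCondition_of_shiftBound` /
`MeasureCorrelation_of`) consumes Proposition 9.6 only through ONE value of its `o_m(1)` (the factor
`2`), i.e. through the `O_m(1)`-form of the Goldston–Yıldırım correlation estimate — and that form is
a THEOREM of the tree (`GreenTao2008.correlation_bound`, file `GreenTao2008CorrelationBound.lean`,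
proved by Selberg's change of variables instead of the printed contour integration). Rescaling the
measure by the constant `K_k = max_{m ≤ 2^{k-1}} C_m ≥ 1` of that bound puts us exactly in the
situation of `correlationCondition_of_shiftBound` with the factor `1 ≤ 1 + η`; the correlation
condition is invariant under rescaling `ν` by a constant (`correlationCondition_of_div_const`: the
weights `τ` absorb `K^m`). -/

/-- The correlation condition is invariant under dividing the measure by a positive constant:
if `ν/K` satisfies it with weights `τ`, then `ν` satisfies it with weights `K^m τ`.
[cite: GreenTaoAnnals2008, Definition 3.2] -/
theorem correlationCondition_of_div_const {m₀ : ℕ} {ν : (N : ℕ) → ZMod N → ℝ} {K : ℝ} (hK : 0 < K)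
    (h : CorrelationCondition m₀ (fun N x => ν N x / K)) : CorrelationCondition m₀ ν := by
  intro m hm1 hmm₀
  obtain ⟨τ, hτ0, hτq, hτc⟩ := h m hm1 hmm₀
  refine ⟨fun N x => K ^ m * τ N x, fun N x => mul_nonneg (pow_nonneg hK.le _) (hτ0 N x), ?_, ?_⟩
  · intro q hq
    obtain ⟨C, hC⟩ := hτq q hq
    refine ⟨(K ^ m) ^ q * C, ?_⟩
    filter_upwards [hC] with N hN
    intro hNp
    have h1 := @hN hNp
    calc 𝔼 x : ZMod N, (K ^ m * τ N x) ^ q = (K ^ m) ^ q * 𝔼 x : ZMod N, τ N x ^ q := by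
          rw [mul_expect]
          exact expect_congr rfl fun x _ => by rw [mul_pow]
      _ ≤ (K ^ m) ^ q * C := mul_le_mul_of_nonneg_left h1 (by positivity)
  · filter_upwards [hτc] with N hN
    intro hNp hh
    have h1 := @hN hNp hh
    have hKm : (0 : ℝ) < K ^ m := pow_pos hK m
    have hdiv : 𝔼 x : ZMod N, ∏ i, ν N (x + hh i) / K = (𝔼 x : ZMod N, ∏ i, ν N (x + hh i)) / K ^ m := by
      rw [expect_div]
      refine expect_congr rfl fun x _ => ?_
      rw [prod_div_distrib, prod_const, card_univ, Fintype.card_fin]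
    rw [hdiv, div_le_iff₀ hKm] at h1
    calc 𝔼 x : ZMod N, ∏ i, ν N (x + hh i) ≤ (∑ i : Fin m, ∑ j : Fin m with i < j, τ N (hh i - hh j)) * K ^ m := h1
      _ = ∑ i : Fin m, ∑ j : Fin m with i < j, K ^ m * τ N (hh i - hh j) := by
          rw [sum_mul]
          refine sum_congr rfl fun i _ => ?_
          rw [sum_mul]
          exact sum_congr rfl fun j _ => mul_comm _ _

/-- **Green–Tao 2008, Proposition 9.10 — DISCHARGED.** The measure `ν` of Definition 9.3 satisfies
the `2^{k-1}`-correlation condition (`k ≥ 3`, `w(N) → ∞` with `w(N) ≤ ⌊log_4 log N⌋`). Proof: the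
printed argument (`correlationCondition_of_shiftBound`: Lemma 9.9, the divisor bound for coincident
shifts, `ν ≤ 1 + g`, expansion over `A ⊆ [m]`) applied to the rescaled measure `ν/K`, with
Proposition 9.6 supplied in its `O_m(1)` form by the tree's THEOREM `correlation_bound` (the constant
`K = ∑_{m ≤ 2^{k-1}} (corrConst m + excConst m)` dominates all the constants that occur), and the
rescaling undone by `correlationCondition_of_div_const`. [cite: GreenTaoAnnals2008, Proposition 9.10] -/
theorem MeasureCorrelation_holds : MeasureCorrelation := by
  classical
  intro k hk
  have hk1 : 1 ≤ k := by omega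
  set m₀ : ℕ := 2 ^ (k - 1) with hm₀_def
  -- the uniform constant
  set K : ℝ := ∑ m ∈ range (m₀ + 1), (corrConst m + excConst m) with hK_def
  have hKterm : ∀ m, 0 ≤ corrConst m + excConst m := fun m =>
    add_nonneg (zero_le_one.trans (one_le_corrConst m)) (excConst_nonneg m)
  have hKge : ∀ m, m ≤ m₀ → corrConst m + excConst m ≤ K := fun m hm =>
    single_le_sum (f := fun m => corrConst m + excConst m) (fun i _ => hKterm i)
      (mem_range.2 (Nat.lt_succ_of_le hm))
  have hK1 : 1 ≤ K := le_trans (one_le_corrConst 0) (le_trans (le_add_of_nonneg_right (excConst_nonneg 0))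
    (hKge 0 (Nat.zero_le _)))
  have hK0 : 0 < K := lt_of_lt_of_le one_pos hK1
  have hKc : ∀ m, m ≤ m₀ → corrConst m ≤ K := fun m hm =>
    le_trans (le_add_of_nonneg_right (excConst_nonneg m)) (hKge m hm)
  have hKe : ∀ m, m ≤ m₀ → excConst m ≤ K := fun m hm =>
    le_trans (le_add_of_nonneg_left (zero_le_one.trans (one_le_corrConst m))) (hKge m hm)
  -- the growth bound
  have hfl : Tendsto (fun N : ℕ => ⌊Real.logb 4 (Real.log N)⌋₊) atTop atTop :=
    tendsto_nat_floor_atTop.comp ((Real.tendsto_logb_atTop (by norm_num)).comp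
      (Real.tendsto_log_atTop.comp tendsto_natCast_atTop_atTop))
  refine ⟨fun N => ⌊Real.logb 4 (Real.log N)⌋₊, hfl, fun w hw hwlog => ?_⟩
  -- rescale
  refine correlationCondition_of_div_const hK0 ?_
  -- the function `g_N` (already divided by `K`)
  set g : ℕ → ℤ → ℝ := fun N n =>
    (if eps k * N ≤ (n : ℝ) ∧ (n : ℝ) ≤ 2 * eps k * N then
      (Nat.totient (primorial (w N)) : ℝ) / primorial (w N) *
        truncatedDivisorSum (gyLevel k N) (primorial (w N) * n + 1) ^ 2 / Real.log (gyLevel k N)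
    else 0) / K with hg_def
  have hg0 : ∀ N n, 0 ≤ g N n := by
    intro N n
    simp only [hg_def]
    refine div_nonneg ?_ hK0.le
    split_ifs
    · exact div_nonneg (mul_nonneg (div_nonneg (Nat.cast_nonneg _) (Nat.cast_nonneg _))
        (sq_nonneg _)) (log_gyLevel_nonneg k N)
    · exact le_rfl
  have hε : eps k < 1 / 4 := by linarith [eps_le k]
  -- shared eventualities
  have hc : 0 < (k : ℝ)⁻¹ * 2⁻¹ ^ (k + 4) := by
    have : (0 : ℝ) < k := by exact_mod_cast hk1
    positivity
  have hlogR1 : ∀ᶠ N : ℕ in atTop, 1 ≤ Real.log (gyLevel k N) := by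
    have ht : Tendsto (fun N : ℕ => Real.log (gyLevel k N)) atTop atTop := by
      simp_rw [log_gyLevel]
      exact Tendsto.const_mul_atTop hc (Real.tendsto_log_atTop.comp tendsto_natCast_atTop_atTop)
    exact ht.eventually_ge_atTop 1
  have hR2 : ∀ᶠ N : ℕ in atTop, 2 ≤ gyLevel k N := by
    have ht : Tendsto (fun N : ℕ => gyLevel k N) atTop atTop := by
      simp_rw [gyLevel_def]
      exact (tendsto_rpow_atTop hc).comp tendsto_natCast_atTop_atTop
    exact ht.eventually_ge_atTop 2
  have hWN : ∀ᶠ N : ℕ in atTop, (primorial (w N) : ℝ) ≤ N := by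
    filter_upwards [eventually_ge_atTop 3] with N hN3
    have hN3' : (3 : ℝ) ≤ N := by exact_mod_cast hN3
    exact (primorial_le_log hN3 (hwlog N)).trans
      ((Real.log_le_sub_one_of_pos (by linarith)).trans (by linarith))
  have hWR : ∀ᶠ N : ℕ in atTop, (primorial (w N) : ℝ) ≤ gyLevel k N := by
    have e2 : ∀ᶠ N : ℕ in atTop, Real.log N ≤ gyLevel k N := by
      have h := (isLittleO_log_rpow_atTop hc).bound (show (0 : ℝ) < 1 by norm_num)
      filter_upwards [tendsto_natCast_atTop_atTop.eventually h, eventually_ge_atTop 1] with N hN hN1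
      rw [one_mul, Real.norm_eq_abs, Real.norm_eq_abs,
        abs_of_nonneg (Real.log_nonneg (by exact_mod_cast hN1)), abs_of_nonneg (by positivity)] at hN
      exact hN
    filter_upwards [e2, eventually_ge_atTop 3] with N hN hN3
    exact (primorial_le_log hN3 (hwlog N)).trans hN
  refine correlationCondition_of_shiftBound g hε (fun N x => div_nonneg (gtMeasure_nonneg k w N x) hK0.le)
    (Filter.Eventually.of_forall ?_) ?_ ?_ ?_
  · ---------------------------------------------------------------- `ν/K ≤ 1 + g`
    intro N x
    simp only [gtMeasure, hg_def, Int.cast_natCast]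
    split_ifs
    · linarith
    · rw [zero_div, add_zero, div_le_one hK0]
      exact hK1
  · ---------------------------------------------------------------- support of `g`
    intro N n hn
    simp only [hg_def] at hn
    split_ifs at hn with hcn
    · exact hcn
    · exact absurd (zero_div K) hn
  · ---------------------------------------------------------------- `‖g_N‖_∞ ≤ N^δ`
    intro δ hδ
    have hδ' : 0 < δ / 16 := by positivity
    obtain ⟨C₁, hC₁, hd⟩ := Literature.NumberTheory.Sieve.exists_card_divisors_le_mul_rpow hδ'
    have e2 : ∀ᶠ N : ℕ in atTop, Real.log N ≤ (N : ℝ) ^ (δ / 16) := by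
      have h := (isLittleO_log_rpow_atTop hδ').bound (show (0 : ℝ) < 1 by norm_num)
      filter_upwards [tendsto_natCast_atTop_atTop.eventually h, eventually_ge_atTop 1] with N hN hN1
      rw [one_mul, Real.norm_eq_abs, Real.norm_eq_abs,
        abs_of_nonneg (Real.log_nonneg (by exact_mod_cast hN1)), abs_of_nonneg (by positivity)] at hN
      exact hN
    have e3 : ∀ᶠ N : ℕ in atTop, C₁ ^ 2 ≤ (N : ℝ) ^ (δ / 2) :=
      ((tendsto_rpow_atTop (show 0 < δ / 2 by positivity)).comp
        tendsto_natCast_atTop_atTop).eventually_ge_atTop _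
    filter_upwards [hlogR1, e2, e3, hWN, eventually_ge_atTop 2] with N h1 h2 h3 h4 hN2 n
    simp only [hg_def]
    split_ifs with hcn
    swap
    · rw [zero_div]; positivity
    obtain ⟨hc1, hc2⟩ := hcn
    have hN0 : (0 : ℝ) < N := by exact_mod_cast (show 0 < N by omega)
    have hN1 : (1 : ℝ) ≤ N := by exact_mod_cast (show 1 ≤ N by omega)
    have hn0 : (0 : ℝ) ≤ n := le_trans (mul_nonneg (eps_pos k).le hN0.le) hc1
    have hnN : (n : ℝ) ≤ N := by
      have := two_mul_eps_lt_one k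
      calc (n : ℝ) ≤ 2 * eps k * N := hc2
        _ ≤ 1 * N := by gcongr
        _ = N := one_mul _
    have hn0' : (0 : ℤ) ≤ n := by exact_mod_cast hn0
    set W : ℕ := primorial (w N) with hW_def
    set n' : ℤ := (W : ℤ) * n + 1 with hn'_def
    have hW1 : (1 : ℤ) ≤ W := by exact_mod_cast primorial_pos (w N)
    have hn'1 : 1 ≤ n' := by
      have : 0 ≤ (W : ℤ) * n := mul_nonneg (by linarith) hn0'
      linarith
    have hn'0 : n' ≠ 0 := by linarith
    have hn'le : ((n'.natAbs : ℕ) : ℝ) ≤ (N : ℝ) ^ (3 : ℕ) := by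
      have habs : ((n'.natAbs : ℕ) : ℝ) = ((n' : ℤ) : ℝ) := by
        rw [Nat.cast_natAbs, Int.cast_abs, abs_of_pos (by exact_mod_cast hn'1)]
      rw [habs, hn'_def]
      push_cast
      have h2N : (2 : ℝ) ≤ N := by exact_mod_cast hN2
      nlinarith [mul_le_mul h4 hnN hn0 hN0.le]
    have hR1 : 1 ≤ gyLevel k N := one_le_gyLevel (by omega)
    have hR0 : 0 < gyLevel k N := by linarith
    have hlogR : Real.log (gyLevel k N) ≤ Real.log N := by
      apply Real.log_le_log hR0
      calc gyLevel k N = (N : ℝ) ^ ((k : ℝ)⁻¹ * 2⁻¹ ^ (k + 4)) := rfl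
        _ ≤ (N : ℝ) ^ (1 : ℝ) := by
            apply Real.rpow_le_rpow_of_exponent_le hN1
            have h1 : (k : ℝ)⁻¹ ≤ 1 := inv_le_one_of_one_le₀ (by exact_mod_cast hk1)
            have h2 : (2⁻¹ : ℝ) ^ (k + 4) ≤ 1 := pow_le_one₀ (by norm_num) (by norm_num)
            exact mul_le_one₀ h1 (by positivity) h2
        _ = N := Real.rpow_one _
    have hΛ := abs_truncatedDivisorSum_le hR1 hn'0
    have hdiv := hd n'.natAbs (Int.natAbs_ne_zero.2 hn'0)
    have hD : (#(n'.natAbs.divisors) : ℝ) ≤ C₁ * (N : ℝ) ^ (3 * (δ / 16)) := by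
      calc (#(n'.natAbs.divisors) : ℝ) ≤ C₁ * ((n'.natAbs : ℕ) : ℝ) ^ (δ / 16) := hdiv
        _ ≤ C₁ * ((N : ℝ) ^ (3 : ℕ)) ^ (δ / 16) := by gcongr
        _ = C₁ * (N : ℝ) ^ (3 * (δ / 16)) := by
            rw [← Real.rpow_natCast, ← Real.rpow_mul hN0.le]; norm_num
    have hΛ' : |truncatedDivisorSum (gyLevel k N) n'| ≤ C₁ * (N : ℝ) ^ (4 * (δ / 16)) := by
      calc |truncatedDivisorSum (gyLevel k N) n'| ≤ #(n'.natAbs.divisors) * Real.log (gyLevel k N) := hΛ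
        _ ≤ (C₁ * (N : ℝ) ^ (3 * (δ / 16))) * (N : ℝ) ^ (δ / 16) :=
            mul_le_mul hD (hlogR.trans h2) (by linarith) (by positivity)
        _ = C₁ * (N : ℝ) ^ (4 * (δ / 16)) := by
            rw [show 4 * (δ / 16) = 3 * (δ / 16) + δ / 16 by ring, Real.rpow_add hN0]; ring
    have hΛ2 : truncatedDivisorSum (gyLevel k N) n' ^ 2 ≤ C₁ ^ 2 * (N : ℝ) ^ (δ / 2) := by
      calc truncatedDivisorSum (gyLevel k N) n' ^ 2 = |truncatedDivisorSum (gyLevel k N) n'| ^ 2 :=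
            (sq_abs _).symm
        _ ≤ (C₁ * (N : ℝ) ^ (4 * (δ / 16))) ^ 2 := pow_le_pow_left₀ (abs_nonneg _) hΛ' 2
        _ = C₁ ^ 2 * ((N : ℝ) ^ (4 * (δ / 16))) ^ 2 := mul_pow _ _ _
        _ = C₁ ^ 2 * (N : ℝ) ^ (δ / 2) := by
            congr 1
            rw [← Real.rpow_natCast, ← Real.rpow_mul hN0.le]
            ring_nf
    have hφW : (Nat.totient W : ℝ) / W ≤ 1 :=
      div_le_one_of_le₀ (by exact_mod_cast Nat.totient_le W) (Nat.cast_nonneg _)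
    have hval0 : 0 ≤ (Nat.totient W : ℝ) / W * truncatedDivisorSum (gyLevel k N) n' ^ 2 / Real.log (gyLevel k N) :=
      div_nonneg (mul_nonneg (by positivity) (sq_nonneg _)) (log_gyLevel_nonneg k N)
    calc (Nat.totient W : ℝ) / W * truncatedDivisorSum (gyLevel k N) n' ^ 2 / Real.log (gyLevel k N) / K
        ≤ (Nat.totient W : ℝ) / W * truncatedDivisorSum (gyLevel k N) n' ^ 2 / Real.log (gyLevel k N) :=
          div_le_self hval0 hK1
      _ ≤ 1 * truncatedDivisorSum (gyLevel k N) n' ^ 2 / 1 := by gcongr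
      _ = truncatedDivisorSum (gyLevel k N) n' ^ 2 := by ring
      _ ≤ C₁ ^ 2 * (N : ℝ) ^ (δ / 2) := hΛ2
      _ ≤ (N : ℝ) ^ (δ / 2) * (N : ℝ) ^ (δ / 2) := by gcongr
      _ = (N : ℝ) ^ δ := by rw [← Real.rpow_add hN0]; ring_nf
  · ---------------------------------------------------------------- Prop 9.6 (O_m(1) form)
    intro m hm1 hm2
    refine ⟨K, hK0.le, fun η hη => ?_⟩
    filter_upwards [hlogR1, hR2, hWR, eventually_ge_atTop 1] with N hlogR hR2N hWRN hN1 hNp h hinj hbdd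
    have hN0 : (0 : ℝ) < N := by exact_mod_cast hN1
    set W : ℕ := primorial (w N) with hW_def
    set R : ℝ := gyLevel k N with hR_def
    have hW0 : (0 : ℝ) < W := by exact_mod_cast primorial_pos (w N)
    have hWne : W ≠ 0 := (primorial_pos (w N)).ne'
    have hφ0 : (0 : ℝ) < Nat.totient W := by exact_mod_cast Nat.totient_pos.2 (primorial_pos (w N))
    have hlogR0 : 0 < Real.log R := by simp only [hR_def]; linarith
    set cN : ℝ := (Nat.totient W : ℝ) / W / Real.log R with hcN_def
    have hcN0 : 0 ≤ cN := by positivity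
    have hgle : ∀ z : ℤ, g N z ≤ cN / K * truncatedDivisorSum R ((W : ℤ) * z + 1) ^ 2 := by
      intro z
      simp only [hg_def]
      split_ifs
      · apply le_of_eq
        simp only [hcN_def, hW_def, hR_def]
        ring
      · rw [zero_div]; positivity
    -- the prime factors of `W` are `≤ w(N) ≤ W ≤ R`
    have hWR' : ∀ p ∈ W.primeFactors, p ≤ ⌊R⌋₊ := by
      intro p hp
      refine Nat.le_floor ?_
      have h1 : (p : ℝ) ≤ W := by exact_mod_cast Nat.le_of_mem_primeFactors hp
      exact h1.trans hWRN
    -- the interval `[0, N)` is long enough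
    have hRN : R ^ (5 * m) ≤ N := by
      have h10 : gyLevel k N ^ (10 * m) ≤ N := gyLevel_pow_le hk1 hm2 hN1
      have hR1 : (1 : ℝ) ≤ R := by simp only [hR_def]; linarith
      exact le_trans (pow_le_pow_right₀ hR1 (by omega)) h10
    -- the correlation bound on `[0, N)`
    have h96 := correlation_bound (m := m) hR2N hWne hWR' h hinj 0 hRN
    rw [zero_add, expect_eq_sum_div_card, Int.card_Ico, sub_zero, Int.toNat_natCast,
      div_le_iff₀ hN0] at h96
    have hpair : corrPairPrimes h = pairPrimeFactors h := rfl
    rw [hpair] at h96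
    have hKm : corrConst m ≤ K := hKc m hm2
    have hKm' : excConst m ≤ K := hKe m hm2
    have hKpow : K ≤ K ^ m := by
      calc K = K ^ 1 := (pow_one K).symm
        _ ≤ K ^ m := pow_le_pow_right₀ hK1 hm1
    calc ∑ y ∈ range N, ∏ i, g N (y + h i)
        ≤ ∑ y ∈ range N, ∏ i, cN / K * truncatedDivisorSum R ((W : ℤ) * (y + h i) + 1) ^ 2 :=
          sum_le_sum fun y _ => prod_le_prod (fun i _ => hg0 N _) (fun i _ => hgle _)
      _ = (cN / K) ^ m * ∑ y ∈ range N, ∏ i, truncatedDivisorSum R ((W : ℤ) * (y + h i) + 1) ^ 2 := by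
          rw [mul_sum]
          refine sum_congr rfl fun y _ => ?_
          rw [prod_mul_distrib, prod_const, card_univ, Fintype.card_fin]
      _ = (cN / K) ^ m * ∑ x ∈ Ico (0 : ℤ) N, ∏ i, truncatedDivisorSum R ((W : ℤ) * (x + h i) + 1) ^ 2 := by
          congr 1
          refine sum_nbij (fun y : ℕ => (y : ℤ)) (fun y hy => mem_Ico.2 ⟨by positivity, ?_⟩)
            (fun a _ b _ hab => Nat.cast_injective hab) (fun x hx => ?_) (fun y _ => rfl)
          · exact_mod_cast mem_range.1 hy
          · obtain ⟨h0, h1⟩ := mem_Ico.1 (mem_coe.1 hx)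
            refine ⟨x.toNat, mem_coe.2 (mem_range.2 ?_), Int.toNat_of_nonneg h0⟩
            omega
      _ ≤ (cN / K) ^ m * (corrConst m * ((W : ℝ) * Real.log R / Nat.totient W) ^ m *
            (∏ p ∈ pairPrimeFactors h, (1 + excConst m * (p : ℝ) ^ (-(1 / 2 : ℝ)))) * N) := by
          gcongr
      _ = (corrConst m / K ^ m) * N * ∏ p ∈ pairPrimeFactors h, (1 + excConst m * (p : ℝ) ^ (-(1 / 2 : ℝ))) := by
          have hone : cN * ((W : ℝ) * Real.log R / Nat.totient W) = 1 := by
            simp only [hcN_def]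
            field_simp
          calc (cN / K) ^ m * (corrConst m * ((W : ℝ) * Real.log R / Nat.totient W) ^ m *
                (∏ p ∈ pairPrimeFactors h, (1 + excConst m * (p : ℝ) ^ (-(1 / 2 : ℝ)))) * N)
              = (cN * ((W : ℝ) * Real.log R / Nat.totient W)) ^ m * ((corrConst m / K ^ m) * N *
                  ∏ p ∈ pairPrimeFactors h, (1 + excConst m * (p : ℝ) ^ (-(1 / 2 : ℝ)))) := by
                rw [div_pow]
                field_simp
                ring
            _ = _ := by rw [hone, one_pow, one_mul]
      _ ≤ 1 * N * ∏ p ∈ pairPrimeFactors h, (1 + K * (p : ℝ) ^ (-(1 / 2 : ℝ))) := by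
          have hq : corrConst m / K ^ m ≤ 1 := by
            rw [div_le_one (pow_pos hK0 m)]; exact hKm.trans hKpow
          have hP0 : 0 ≤ ∏ p ∈ pairPrimeFactors h, (1 + excConst m * (p : ℝ) ^ (-(1 / 2 : ℝ))) :=
            prod_nonneg fun p _ => add_nonneg zero_le_one
              (mul_nonneg (excConst_nonneg m) (Real.rpow_nonneg (Nat.cast_nonneg _) _))
          refine mul_le_mul (mul_le_mul_of_nonneg_right hq hN0.le) ?_ hP0 (by positivity)
          exact prod_le_prod (fun p _ => add_nonneg zero_le_one
              (mul_nonneg (excConst_nonneg m) (Real.rpow_nonneg (Nat.cast_nonneg _) _)))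
            fun p _ => add_le_add le_rfl (mul_le_mul_of_nonneg_right hKm' (Real.rpow_nonneg (Nat.cast_nonneg _) _))
      _ ≤ (1 + η) * N * ∏ p ∈ pairPrimeFactors h, (1 + K * (p : ℝ) ^ (-(1 / 2 : ℝ))) := by
          have hP0 : 0 ≤ ∏ p ∈ pairPrimeFactors h, (1 + K * (p : ℝ) ^ (-(1 / 2 : ℝ))) :=
            prod_nonneg fun p _ => add_nonneg zero_le_one
              (mul_nonneg hK0.le (Real.rpow_nonneg (Nat.cast_nonneg _) _))
          gcongr
          linarith

end Literature.NumberTheory.Sieve.GreenTao2008
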